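import Literature.Combinatorics.Optimization.BlockPsdLiftFactorization
import Literature.Combinatorics.Hypergraph.RamseyTheorem
import Literature.Combinatorics.SimpleGraph.LovaszThetaPenalty
import Literature.Analysis.Convex.SecondOrderConePrograms
import Literature.Algebra.Polynomial.UnivariateNonnegSumOfSquares
import HarnessLib

/-!
# Neighborliness obstructs lifts with small psd blocks (Averkov 2019; Saunderson 2020; Fawzi 2018)

G. Averkov, *Optimal size of linear matrix inequalities in semidefinite approaches to polynomial
optimization*, SIAM J. Appl. Algebra Geom. 3 (2019) 128–151 = arXiv:1806.08656 [Averkov2019] (held text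
`paper:arxiv-1806.08656`, p10–p11: "k-neighborly configuration", Lemma 24, Lemma 25, Lemma 26 "Key lemma");
J. Saunderson, *Limitations on the expressive power of convex cones without long chains of faces*,
SIAM J. Optim. 30 (2020) 1033–1047 = arXiv:1902.06401 [Saunderson2019] (held text `paper:arxiv-1902.06401`,
p04 Def. 1.2 / Ex. 1.3 / Thm. 1.4, p10 Thm. 3.5 (Ramsey), p11 Lemma 4.1 (Averkov) / Lemma 4.3 (Averkov's main
lemma), p12 Prop. 4.5); H. Fawzi, J. Gouveia, P. A. Parrilo, J. Saunderson, R. R. Thomas, *Lifting for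
simplicity*, SIAM Rev. 64 (2022) = arXiv:2002.09788 [FawziEtAl2022Lifting] (p25 Def. 5.8, Ex. 5.9, Thm. 5.10;
p26 Thm. 5.11); H. Fawzi, *On representing the positive semidefinite cone using the second-order cone*,
Math. Program. 175 (2019) = arXiv:1610.04901 [Fawzi2016] (p03 Thm. 1, p07 §4).

Everything here is PROVED (no facts). The tree supplies: `(S^d_+)^r`-lifts `HasBlockPsdLift` and the
factorization theorem `HasBlockPsdLift.hasPsdPowerFactorization_slack` (`BlockPsdLiftFactorization.lean`,
FP13 Thm. 2 / GPT13 Thm. 2.4, direction "lift ⇒ factorization", bounded sets), Ramsey's theorem for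
`r`-subsets `Literature.Combinatorics.Hypergraph.exists_ramsey_finite`, the complementarity lemma
`trace_mul_eq_zero_iff` (`tr(AB) = 0 ⇔ AB = 0` for `A, B ⪰ 0`) and the spectraplex predicate
`Literature.Combinatorics.SimpleGraph.IsSpectraplex` (`B ⪰ 0`, `Tr B = 1`).

## Contents (printed statement → Lean)

* Saunderson Lemma 4.1 = Averkov Lemma 24, in the dual (kernel) form used below:
  `exists_subset_card_add_finrank_iInf_le` — for submodules `U_a` (`a ∈ W`) of a finite-dimensional
  space there is `I ⊆ W` with `|I| + dim ⋂_{a ∈ W} U_a ≤ dim V` and `⋂_{a ∈ I} U_a = ⋂_{a ∈ W} U_a`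
  (for `U_a = ker X_a`, `X_a ⪰ 0`: `|I| ≤ rank Σ_{a ∈ W} X_a`, `ker Σ_I X_a = ker Σ_W X_a`, which is the
  printed statement since `ker Σ = ⋂ ker` for psd families, `ker_toLin'_sum_eq_iInf_of_posSemidef`).
* **Averkov's key lemma** (Averkov Lemma 26 p11 = Saunderson Lemma 4.3 p11):
  `averkov_key_lemma` — for all `k m` there is `R` (a hypergraph Ramsey number `R_k(k+1; (k+1)^m)`)
  such that whenever `a_T, b_s ∈ (S^k_+)^m` (`T ∈ binom(S,k)`, `s ∈ S`) satisfy
  `Σ_i ⟨a_{T,i}, b_{s,i}⟩ = 0 ⇔ s ∈ T`, then `|S| < R`. PROVED following the printed proof: colour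
  `T ↦ (dim ⋂_{t ∈ T} ker b_{t,i})_i`, take a monochromatic `(k+1)`-set `W` (Ramsey), show the kernels
  `⋂_{t∈T} ker b_{t,i}` do not depend on the `k`-subset `T ⊆ W` (Lemma 4.1), and conclude from
  `⟨A,B⟩ = 0 ⇔ range A ⊆ ker B` (Averkov Lemma 25) that `Σ_i ⟨a_{T,i}, b_{s,i}⟩ = 0` for the point
  `s ∈ W ∖ T`, a contradiction.
* **Neighborliness** (FGPST Def. 5.8 p25 / Saunderson Def. 1.2 p04 / Averkov p10 "k-neighborly
  configuration"), affine form for point sets of a convex set in coordinates: `IsNeighborlyWrt C k P` —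
  every `k`-subset `I ⊆ P` is cut out of `P` by a valid inequality of `C` (`aᵀy ≤ β` on `C`,
  `aᵀx = β ⇔ x ∈ I` on `P`).
* **Saunderson Prop. 4.5 (p12) for `K_i = S^k_+`** (quantitative form):
  `exists_card_lt_of_isNeighborlyWrt_of_hasBlockPsdLift` — there is `R = R(k,m)` such that every finite
  `P ⊆ C`, `C` bounded with an `(S^k_+)^m`-lift and `k`-neighborly with respect to `P`, has `|P| < R`.
* **Averkov's theorem / FGPST Thm. 5.11 for products of psd cones / Saunderson Thm. 1.4 with
  `K_i = S^k_+` (`ℓ(S^k_+) = k + 1`)**: `not_hasBlockPsdLift_of_isNeighborlyWrt` — a bounded convex set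
  that is `k`-neighborly with respect to arbitrarily large finite subsets has no `(S^k_+)^m`-lift, for
  any `m`. (`k = 2`: FGPST Thm. 5.10 = Fawzi's theorem, second-order-cone lifts being `(S^2_+)^m`-lifts,
  `BlockPsdLiftFactorization.posSemidef_lorentz_two_iff`.)
* **Example (Saunderson Ex. 1.3 p04 / FGPST Ex. 5.9 p25)**: the `(k+1) × (k+1)` spectraplex is
  `k`-neighborly with respect to the rank-one points `v_t v_tᵀ/|v_t|²`, `v_t = (1, t, …, t^k)`, `t ∈ ℕ`
  (`isNeighborlyWrt_spectraplexFlat_momentPoints`, via the functional `X ↦ −cᵀXc`, `c` the coefficient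
  vector of `Π_{t ∈ I}(x − t)`); hence **the `(k+1) × (k+1)` spectraplex and the cone `S^{k+1}_+` have no
  `(S^k_+)^m`-lift for any `m`** (`not_hasBlockPsdLift_spectraplex`, `not_hasBlockPsdLift_posSemidef`;
  Averkov 2019 Cor. of Thm. 2 for `S^{k+1}_+`; `k = 2`: Fawzi 2016/2019 Thm. 1 p03, "`S^3_+` does not admit
  any second-order-cone lift").

* **Averkov Def. 1 / Cor. 6: `sxd(S^{k+1}_+) = k + 1`** — `isLeast_blockSize_hasBlockPsdLift_posSemidef`
  (and `…_spectraplex`): the least block size `d` with an `(S^d_+)^m`-lift (some `m`) is `k + 1`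
  (identity lift `hasBlockPsdLift_posSemidef_self` + `HasBlockPsdLift.mono_size`).
* **FGPST §5.1.3 remark / Averkov Prop. 7 (Ben-Tal–Nemirovski): `L^{ℓ+1}_+` has an `(S^2_+)^ℓ`-lift** —
  `hasBlockPsdLift_soc` over the tree's `SecondOrderConePrograms.soc (EuclideanSpace ℝ (Fin ℓ))`
  (tower of blocks `[[y_i, x_i], [x_i, t]] ⪰ 0`, `Σ y_i = t`), so second-order-cone lifts are
  `(S^2_+)^m`-lifts (conversely `S^2_+ ≅ L^3_+`, `posSemidef_lorentz_two_iff`).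
* **Fawzi §4 sandwiched form** — `IsNeighborlyWrt.anti`, `not_hasBlockPsdLift_of_momentPoint_mem`,
  `not_hasBlockPsdLift_of_vecMulVec_momentVec_mem`: no `(S^k_+)^m`-liftable set lies between the rank-one
  moment matrices and `S^{k+1}_+`.
* **Averkov's own orientation of Thm. 2 (condition (∗): points `f_T ∈ C` indexed by `k`-subsets,
  evaluation-type valid inequalities indexed by `S`)** — `exists_card_lt_of_zeroPattern_of_hasBlockPsdLift`,
  `not_hasBlockPsdLift_of_zeroPattern` (`k, m ≥ 1`).
* **Averkov Cor. 4 for `n = 1` / Thm. 9: `sxd(Σ_{1,2d}) = d + 1`** — the cone `nonnegPolyCoeff (2d+1)` of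
  univariate polynomials of degree `≤ 2d` nonnegative on `ℝ` (coefficient coordinates) has an
  `S^{d+1}_+`-lift (`hasBlockPsdLift_nonnegPolyCoeff_succ`, Gram map `gramCoeff` + the tree's "nonnegative
  univariate = sum of two squares" `UnivariateNonnegSumOfSquares.exists_sq_add_sq_of_nonneg`) and NO
  `(S^d_+)^m`-lift for any `m` (`not_hasBlockPsdLift_nonnegPolyCoeff`: the points `Π_{t∈T}(x−t)²`, `T` a
  `d`-subset of `{0,…,N−1}`, against the evaluations at `0,…,N−1`, on the bounded section
  `Σ_{s≤2d} p(s) = 1`); `isLeast_blockSize_hasBlockPsdLift_nonnegPolyCoeff`.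

What is NOT here: Saunderson's Thm. 1.4 for general cones `K_i` with `ℓ(K_i) ≤ k+1` (needs the face
lattice / longest-chain invariant of an abstract closed convex cone; the psd case is the one with
`faces = kernels`), Averkov's Thm. 2 / Cor. 3–5 for `n ≥ 2` variables (needs the generic
`binom(n+d,n) − 1`-neighborly moment configurations of Averkov Lemmas 27–31; `n = 1` is above), and any
quantitative Ramsey bound.
-/

noncomputable section

open Finset Matrix
open scoped MatrixOrder

namespace Literature.Combinatorics.Optimization

open Literature.Computation.Certificates.SemidefiniteComplementarity (trace_mul_eq_zero_iff
  trace_mul_eq_zero_iff' frob frob_nonneg_of_posSemidef)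

universe u

/-! ### Kernels of sums of positive semidefinite matrices -/

/-- For `X, Y ⪰ 0`, `ker (X + Y) = ker X ∩ ker Y` (`vᵀ(X+Y)v = 0` forces `vᵀXv = vᵀYv = 0`).
[cite: Saunderson2019, Lemma 3.1 (face arithmetic, `F(x+y) = F(x) ∨ F(y)`) (p09)] -/
theorem ker_toLin'_add_of_posSemidef {n : Type*} [Fintype n] [DecidableEq n] {X Y : Matrix n n ℝ}
    (hX : X.PosSemidef) (hY : Y.PosSemidef) :
    LinearMap.ker (Matrix.toLin' (X + Y)) =
      LinearMap.ker (Matrix.toLin' X) ⊓ LinearMap.ker (Matrix.toLin' Y) := by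
  ext v
  simp only [Submodule.mem_inf, LinearMap.mem_ker, Matrix.toLin'_apply, add_mulVec]
  constructor
  · intro h
    have hx := hX.dotProduct_mulVec_nonneg v
    have hy := hY.dotProduct_mulVec_nonneg v
    have hsum : star v ⬝ᵥ (X *ᵥ v) + star v ⬝ᵥ (Y *ᵥ v) = 0 := by
      rw [← dotProduct_add, h, dotProduct_zero]
    have hx0 : star v ⬝ᵥ (X *ᵥ v) = 0 := le_antisymm (by linarith) hx
    have hy0 : star v ⬝ᵥ (Y *ᵥ v) = 0 := le_antisymm (by linarith) hy
    exact ⟨(hX.dotProduct_mulVec_zero_iff v).1 hx0, (hY.dotProduct_mulVec_zero_iff v).1 hy0⟩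
  · rintro ⟨h1, h2⟩
    rw [h1, h2, add_zero]

/-- A finite sum of positive semidefinite matrices is positive semidefinite. [folklore] -/
private theorem posSemidef_sum_of_posSemidef {n : Type*} [Fintype n] {α : Type*} (s : Finset α)
    {X : α → Matrix n n ℝ} (hX : ∀ a ∈ s, (X a).PosSemidef) : (∑ a ∈ s, X a).PosSemidef := by
  classical
  induction s using Finset.induction_on with
  | empty => simpa using PosSemidef.zero
  | insert a s ha ih =>
    rw [Finset.sum_insert ha]
    exact (hX a (mem_insert_self a s)).add (ih fun b hb => hX b (mem_insert_of_mem hb))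

/-- For a family of psd matrices, `ker Σ_{a ∈ s} X_a = ⋂_{a ∈ s} ker X_a` — the psd-cone instance of
"the minimal face of a sum is the join of the minimal faces" (faces of `S^k_+` are indexed by kernels).
[cite: Saunderson2019, Lemma 3.1 (p09)] [cite: Averkov2019, Lemma 26 proof, eq. (U:def) (p11)] -/
theorem ker_toLin'_sum_eq_iInf_of_posSemidef {n : Type*} [Fintype n] [DecidableEq n] {α : Type*}
    (s : Finset α) {X : α → Matrix n n ℝ} (hX : ∀ a ∈ s, (X a).PosSemidef) :
    LinearMap.ker (Matrix.toLin' (∑ a ∈ s, X a)) = ⨅ a ∈ s, LinearMap.ker (Matrix.toLin' (X a)) := by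
  classical
  induction s using Finset.induction_on with
  | empty => simp
  | insert a s ha ih =>
    rw [Finset.sum_insert ha, ker_toLin'_add_of_posSemidef (hX a (mem_insert_self a s))
      (posSemidef_sum_of_posSemidef s fun b hb => hX b (mem_insert_of_mem hb)),
      ih fun b hb => hX b (mem_insert_of_mem hb), Finset.iInf_insert]

/-- **`⟨A, B⟩ = 0 ⇔ range A ⊆ ker B`** for `A, B ⪰ 0` (Averkov Lemma 25: "`⟨A,B⟩ = 0` holds if and only
if `im(A)` is orthogonal to `im(B)`"; for symmetric `B`, `im(B)^⊥ = ker B`).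
[cite: Averkov2019, Lemma 25 (p10)] -/
theorem trace_mul_eq_zero_iff_range_le_ker {n : Type*} [Fintype n] [DecidableEq n]
    {A B : Matrix n n ℝ} (hA : A.PosSemidef) (hB : B.PosSemidef) :
    (A * B).trace = 0 ↔ LinearMap.range (Matrix.toLin' A) ≤ LinearMap.ker (Matrix.toLin' B) := by
  rw [LinearMap.range_le_ker_iff, ← Matrix.toLin'_mul, LinearEquiv.map_eq_zero_iff]
  exact trace_mul_eq_zero_iff' hA hB

/-! ### Saunderson's Lemma 4.1 / Averkov's Lemma 24 (kernel form) -/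

/-- **Few members already cut out the intersection** (Averkov Lemma 24 "`U = Σ_{i ∈ I} U_i` with
`|I| ≤ k`" / Saunderson Lemma 4.1 "`col(Σ_{i∈I} X_i) = col(Σ_{i∈[n]} X_i)` with `|I| ≤ rank`", stated
dually for intersections of subspaces): for submodules `U_a`, `a ∈ W`, of a finite-dimensional space
`M` there is `I ⊆ W` with `|I| + dim(⋂_{a∈W} U_a) ≤ dim M` and `⋂_{a∈I} U_a = ⋂_{a∈W} U_a`. (Greedy:
keep `a` only if it shrinks the running intersection, which then drops in dimension.)
[cite: Averkov2019, Lemma 24 (p10)] [cite: Saunderson2019, Lemma 4.1 (p11)] -/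
theorem exists_subset_card_add_finrank_iInf_le {M : Type*} [AddCommGroup M] [Module ℝ M]
    [FiniteDimensional ℝ M] {α : Type*} (U : α → Submodule ℝ M) (W : Finset α) :
    ∃ I ⊆ W, I.card + Module.finrank ℝ ↥(⨅ a ∈ W, U a) ≤ Module.finrank ℝ M ∧
      (⨅ a ∈ I, U a) = ⨅ a ∈ W, U a := by
  classical
  induction W using Finset.induction_on with
  | empty =>
    refine ⟨∅, subset_rfl, ?_, rfl⟩
    rw [card_empty, zero_add]
    exact Submodule.finrank_le _
  | insert w W₀ hw ih =>
    obtain ⟨I₀, hI₀W, hcard, hker⟩ := ih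
    by_cases hle : (⨅ a ∈ W₀, U a) ≤ U w
    · refine ⟨I₀, hI₀W.trans (subset_insert _ _), ?_, ?_⟩
      · rw [Finset.iInf_insert, inf_eq_right.2 hle]
        exact hcard
      · rw [Finset.iInf_insert, inf_eq_right.2 hle]
        exact hker
    · refine ⟨insert w I₀, insert_subset_insert _ hI₀W, ?_, ?_⟩
      · have hlt : (⨅ a ∈ insert w W₀, U a) < ⨅ a ∈ W₀, U a := by
          rw [Finset.iInf_insert]
          exact lt_of_le_of_ne inf_le_right fun h => hle ((le_of_eq h.symm).trans inf_le_left)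
        have hfin := Submodule.finrank_lt_finrank_of_lt hlt
        rw [card_insert_of_notMem fun h => hw (hI₀W h)]
        omega
      · rw [Finset.iInf_insert, Finset.iInf_insert, hker]

/-- The printed form of Saunderson's Lemma 4.1 for `S^k_+` (via `ker Σ = ⋂ ker`): for psd
`X_a` (`a ∈ W`) there is `I ⊆ W` with `|I| ≤ rank(Σ_{a∈W} X_a)` and `ker(Σ_{a∈I} X_a) = ker(Σ_{a∈W} X_a)`
(equality of kernels = equality of column spaces for symmetric matrices).
[cite: Saunderson2019, Lemma 4.1 (p11)] [cite: Averkov2019, Lemma 24 (p10)] -/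
theorem exists_subset_card_le_rank_ker_sum_eq {k : ℕ} {α : Type*} (X : α → Matrix (Fin k) (Fin k) ℝ)
    (W : Finset α) (hX : ∀ a ∈ W, (X a).PosSemidef) :
    ∃ I ⊆ W, I.card ≤ (∑ a ∈ W, X a).rank ∧
      LinearMap.ker (Matrix.toLin' (∑ a ∈ I, X a)) = LinearMap.ker (Matrix.toLin' (∑ a ∈ W, X a)) := by
  classical
  obtain ⟨I, hIW, hcard, hker⟩ :=
    exists_subset_card_add_finrank_iInf_le (fun a => LinearMap.ker (Matrix.toLin' (X a))) W
  refine ⟨I, hIW, ?_, ?_⟩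
  · have hrn := LinearMap.finrank_range_add_finrank_ker (Matrix.toLin' (∑ a ∈ W, X a))
    rw [Module.finrank_fin_fun] at hrn hcard
    rw [Matrix.rank, ← ker_toLin'_sum_eq_iInf_of_posSemidef W hX] at *
    change I.card ≤ Module.finrank ℝ ↥(LinearMap.range (Matrix.toLin' (∑ a ∈ W, X a)))
    omega
  · rw [ker_toLin'_sum_eq_iInf_of_posSemidef W hX,
      ker_toLin'_sum_eq_iInf_of_posSemidef I fun a ha => hX a (hIW ha), hker]

/-! ### Averkov's key lemma (Saunderson's Lemma 4.3) -/

/-- **Averkov's key lemma** (Averkov 2019 Lemma 26; Saunderson 2020 Lemma 4.3 "Averkov's main lemma",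
the case `K_i = S^k_+` of his Lemma 4.4). For all `k, m` there is a number `R` (the hypergraph Ramsey
number `R_k(k+1; (k+1)^m)` of the printed proof) such that: if `S` is a finite set and
`a_T = (a_{T,1}, …, a_{T,m}) ∈ (S^k_+)^m` (`T` a `k`-subset of `S`), `b_s = (b_{s,1}, …, b_{s,m}) ∈ (S^k_+)^m`
(`s ∈ S`) satisfy "`⟨a_T, b_s⟩ = Σ_i tr(a_{T,i} b_{s,i}) = 0` if and only if `s ∈ T`", then `|S| < R`.
PROVED following the printed proof: colour each `k`-subset `T` by the tuple of dimensions of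
`⋂_{t∈T} ker b_{t,i}` (`(k+1)^m` colours); by Ramsey (`exists_ramsey_finite`) a `(k+1)`-set `W ⊆ S` is
monochromatic; by Lemma 4.1 the subspaces `⋂_{t∈T} ker b_{t,i}` themselves are then the same for all
`k`-subsets `T ⊆ W` (Claim); writing `W = T ∪ {s}`, `⟨a_{T,i}, b_{t,i}⟩ = 0` for `t ∈ T` puts
`range a_{T,i}` inside `⋂_{t∈T} ker b_{t,i} = ⋂_{w∈W} ker b_{w,i} ⊆ ker b_{s,i}`, so `⟨a_T, b_s⟩ = 0` with
`s ∉ T` — a contradiction. (The maps are total functions; only their values on `k`-subsets of `S`,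
resp. on `S`, matter.) [cite: Averkov2019, Lemma 26 "Key lemma" (p11)]
[cite: Saunderson2019, Lemma 4.3 and Lemma 4.4 with proof (p11–p12); Thm. 3.5 (Ramsey, p10)] -/
theorem averkov_key_lemma (k m : ℕ) :
    ∃ R : ℕ, ∀ {α : Type u} (S : Finset α) (a : Finset α → Fin m → Matrix (Fin k) (Fin k) ℝ)
      (b : α → Fin m → Matrix (Fin k) (Fin k) ℝ),
      (∀ T ∈ S.powersetCard k, ∀ i, (a T i).PosSemidef) → (∀ s ∈ S, ∀ i, (b s i).PosSemidef) →
      (∀ T ∈ S.powersetCard k, ∀ s ∈ S, (∑ i, (a T i * b s i).trace = 0 ↔ s ∈ T)) → S.card < R := by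
  obtain ⟨N, hN⟩ :=
    Literature.Combinatorics.Hypergraph.exists_ramsey_finite.{u} k (k + 1) (Fin m → Fin (k + 1))
  refine ⟨N, fun {α} S a b ha hb hab => ?_⟩
  classical
  by_contra hcon
  rw [not_lt] at hcon
  -- the kernels `K T i = ⋂_{t ∈ T} ker b_{t,i}` and the colouring by their dimensions
  let K : Finset α → Fin m → Submodule ℝ (Fin k → ℝ) := fun T i =>
    ⨅ t ∈ T, LinearMap.ker (Matrix.toLin' (b t i))
  have hKk : ∀ T i, Module.finrank ℝ ↥(K T i) ≤ k := fun T i =>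
    (Submodule.finrank_le (K T i)).trans (Module.finrank_fin_fun ℝ).le
  have hKanti : ∀ {T T' : Finset α} (i : Fin m), T ⊆ T' → K T' i ≤ K T i := fun i hTT' =>
    biInf_mono fun t ht => hTT' ht
  let c : Finset α → (Fin m → Fin (k + 1)) := fun T i => ⟨Module.finrank ℝ ↥(K T i), Nat.lt_succ_of_le (hKk T i)⟩
  obtain ⟨W, hWS, hWcard, e, he⟩ := hN S hcon c
  have hcval : ∀ T ∈ W.powersetCard k, ∀ i, Module.finrank ℝ ↥(K T i) = (e i : ℕ) := fun T hT i => by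
    have h := congrArg (fun f : Fin m → Fin (k + 1) => (f i : ℕ)) (he T hT)
    exact h
  -- Claim: the kernels do not depend on the `k`-subset `T ⊆ W`
  have hclaim : ∀ T ∈ W.powersetCard k, ∀ i, K T i = K W i := by
    intro T hT i
    obtain ⟨hTW, hTc⟩ := mem_powersetCard.1 hT
    by_contra hne
    have hlt : K W i < K T i := lt_of_le_of_ne (hKanti i hTW) (Ne.symm hne)
    have hfin : Module.finrank ℝ ↥(K W i) < Module.finrank ℝ ↥(K T i) :=
      Submodule.finrank_lt_finrank_of_lt hlt
    obtain ⟨I, hIW, hIcard, hIK⟩ :=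
      exists_subset_card_add_finrank_iInf_le (fun t => LinearMap.ker (Matrix.toLin' (b t i))) W
    have hIk : I.card ≤ k := by
      have hk' : Module.finrank ℝ (Fin k → ℝ) = k := Module.finrank_fin_fun ℝ
      change I.card + Module.finrank ℝ ↥(K W i) ≤ Module.finrank ℝ (Fin k → ℝ) at hIcard
      omega
    obtain ⟨T'', hIT'', hT''W, hT''card⟩ := Finset.exists_subsuperset_card_eq hIW hIk (by omega)
    have hKT'' : K T'' i = K W i :=
      le_antisymm ((hKanti i hIT'').trans (le_of_eq hIK)) (hKanti i hT''W)
    have h1 := hcval T'' (mem_powersetCard.2 ⟨hT''W, hT''card⟩) i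
    have h2 := hcval T hT i
    rw [hKT''] at h1
    omega
  -- `W = T ∪ {s}`
  obtain ⟨s, hs⟩ : W.Nonempty := by rw [← card_pos, hWcard]; exact Nat.succ_pos k
  set T := W.erase s with hTdef
  have hTW : T ⊆ W := erase_subset s W
  have hTcard : T.card = k := by rw [hTdef, card_erase_of_mem hs, hWcard, Nat.add_sub_cancel]
  have hTpow : T ∈ W.powersetCard k := mem_powersetCard.2 ⟨hTW, hTcard⟩
  have hTS : T ∈ S.powersetCard k := mem_powersetCard.2 ⟨hTW.trans hWS, hTcard⟩
  have hsS : s ∈ S := hWS hs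
  have hsT : s ∉ T := by rw [hTdef]; exact notMem_erase s W
  -- `⟨a_{T,i}, b_{t,i}⟩ = 0` for `t ∈ T`, termwise
  have hzero : ∀ t ∈ T, ∀ i, (a T i * b t i).trace = 0 := by
    intro t ht i
    have htS : t ∈ S := hWS (hTW ht)
    have hsum := (hab T hTS t htS).2 ht
    have hnn : ∀ j ∈ (univ : Finset (Fin m)), 0 ≤ (a T j * b t j).trace := fun j _ =>
      frob_nonneg_of_posSemidef (ha T hTS j) (hb t htS j)
    exact (sum_eq_zero_iff_of_nonneg hnn).1 hsum i (mem_univ i)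
  -- `range a_{T,i} ⊆ ⋂_{t∈T} ker b_{t,i} = ⋂_{w∈W} ker b_{w,i} ⊆ ker b_{s,i}`
  have hfinal : ∀ i, (a T i * b s i).trace = 0 := by
    intro i
    have hrange : LinearMap.range (Matrix.toLin' (a T i)) ≤ K T i :=
      le_iInf₂ fun t ht =>
        (trace_mul_eq_zero_iff_range_le_ker (ha T hTS i) (hb t (hWS (hTW ht)) i)).1 (hzero t ht i)
    have h1 : LinearMap.range (Matrix.toLin' (a T i)) ≤ LinearMap.ker (Matrix.toLin' (b s i)) :=
      (hrange.trans (le_of_eq (hclaim T hTpow i))).trans (iInf₂_le s hs)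
    exact (trace_mul_eq_zero_iff_range_le_ker (ha T hTS i) (hb s hsS i)).2 h1
  exact hsT ((hab T hTS s hsS).1 (sum_eq_zero fun i _ => hfinal i))

/-! ### Neighborliness and block-psd lifts -/

/-- **`k`-neighborly with respect to a point set** (FGPST Def. 5.8 "`C` is `k`-neighborly with respect
to `V ⊆ ext(C)` if, for every `I ⊂ V` with `|I| = k` there exists `ℓ_I ∈ C°` such that `ℓ_I(x) = 1` for
`x ∈ I` and `ℓ_I(x) < 1` for all `x ∈ V ∖ I`"; Saunderson Def. 1.2 (cones, `f_W ∈ C^*`); Averkov p10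
"`k`-neighborly configuration": "for each `k`-element subset `T` of `S`, there exists a supporting
hyperplane `H` of `C` satisfying `H ∩ S = T`"), in the affine form for a set `C ⊆ ℝ^V` and a finite point
set `P`: every `k`-subset `I ⊆ P` is cut out of `P` by an inequality `aᵀy ≤ β` valid on `C` (`aᵀx = β`
exactly for the points `x ∈ I` of `P`). For `P ⊆ C` this is the printed condition (`= β` on `I`, `< β` on
`P ∖ I`, `isNeighborlyWrt_iff_lt`); the translation-invariant affine form replaces "`ℓ_I ∈ C°`" (which
presupposes `0 ∈ int C`). A `k`-neighborly polytope is `k`-neighborly with respect to its vertex set.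
[cite: FawziEtAl2022Lifting, Def. 5.7–5.8 (§5.1.3, p24–p25)] [cite: Saunderson2019, Def. 1.2 (p04)]
[cite: Averkov2019, §4 "k-neighborly configuration" (p10)] -/
def IsNeighborlyWrt {V : Type*} [Fintype V] (C : Set (V → ℝ)) (k : ℕ) (P : Finset (V → ℝ)) : Prop :=
  ∀ I ⊆ P, I.card = k →
    ∃ (a : V → ℝ) (β : ℝ), (∀ y ∈ C, a ⬝ᵥ y ≤ β) ∧ ∀ x ∈ P, (a ⬝ᵥ x = β ↔ x ∈ I)

/-- Neighborliness with respect to `P` is inherited by subsets of `P`.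
[cite: Saunderson2019, remark after Thm. 1.4 (p04)] -/
theorem IsNeighborlyWrt.mono {V : Type*} [Fintype V] {C : Set (V → ℝ)} {k : ℕ} {P P' : Finset (V → ℝ)}
    (h : IsNeighborlyWrt C k P) (hP' : P' ⊆ P) : IsNeighborlyWrt C k P' := by
  intro I hI hIk
  obtain ⟨a, β, hval, hexact⟩ := h I (hI.trans hP') hIk
  exact ⟨a, β, hval, fun x hx => hexact x (hP' hx)⟩

/-- Neighborliness with respect to `P` passes to SUBSETS `C' ⊆ C` of the body (containing the points or
not): an inequality valid on `C` is valid on `C'`. This is why the obstruction applies to every set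
sandwiched between the points and `C` (Fawzi: "there is no second-order cone representable set that is
contained between `C` and `S^3_+`"). [cite: Fawzi2016, §4 (p07)] [cite: FawziEtAl2022Lifting, Def. 5.8 (p25)] -/
theorem IsNeighborlyWrt.anti {V : Type*} [Fintype V] {C C' : Set (V → ℝ)} {k : ℕ} {P : Finset (V → ℝ)}
    (h : IsNeighborlyWrt C k P) (hC' : C' ⊆ C) : IsNeighborlyWrt C' k P := by
  intro I hI hIk
  obtain ⟨a, β, hval, hexact⟩ := h I hI hIk
  exact ⟨a, β, fun y hy => hval y (hC' hy), hexact⟩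

/-- For `P ⊆ C`, the defining condition reads as printed: `aᵀx = β` on `I` and `aᵀx < β` on `P ∖ I`.
[cite: FawziEtAl2022Lifting, Def. 5.8 (p25)] -/
theorem isNeighborlyWrt_iff_lt {V : Type*} [Fintype V] {C : Set (V → ℝ)} {k : ℕ} {P : Finset (V → ℝ)}
    (hPC : (↑P : Set (V → ℝ)) ⊆ C) :
    IsNeighborlyWrt C k P ↔ ∀ I ⊆ P, I.card = k →
      ∃ (a : V → ℝ) (β : ℝ), (∀ y ∈ C, a ⬝ᵥ y ≤ β) ∧ (∀ x ∈ I, a ⬝ᵥ x = β) ∧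
        ∀ x ∈ P, x ∉ I → a ⬝ᵥ x < β := by
  refine forall₃_congr fun I hI hIk => ?_
  constructor
  · rintro ⟨a, β, hval, hex⟩
    refine ⟨a, β, hval, fun x hx => (hex x (hI hx)).2 hx, fun x hx hxI => ?_⟩
    exact lt_of_le_of_ne (hval x (hPC hx)) fun h => hxI ((hex x hx).1 h)
  · rintro ⟨a, β, hval, hI', hlt⟩
    refine ⟨a, β, hval, fun x hx => ⟨fun h => ?_, fun hxI => hI' x hxI⟩⟩
    by_contra hxI
    exact (hlt x hx hxI).ne h

/-- Degenerate blocks: an `(S^d_+)^r`-lift with `d = 0` or `r = 0` lifts only subsets of `{0}` (the cone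
is a point). [cite: GouveiaParriloThomas2013, Def. 2.2 (§2)] -/
theorem HasBlockPsdLift.subset_zero_of_eq_zero {E : Type*} [AddCommGroup E] [Module ℝ E] {C : Set E}
    {d r : ℕ} (h : HasBlockPsdLift C d r) (h0 : d = 0 ∨ r = 0) : C ⊆ {0} := by
  obtain ⟨L, π, rfl⟩ := h
  have hsub : Subsingleton (Fin r → Matrix (Fin d) (Fin d) ℝ) := by
    rcases h0 with rfl | rfl
    · infer_instance
    · infer_instance
  rintro _ ⟨M, -, rfl⟩
  rw [Set.mem_singleton_iff, Subsingleton.elim M 0, map_zero]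

/-- **Saunderson's Proposition 4.5 for `K_i = S^k_+` (quantitative neighborliness obstruction).** For all
`k, m` there is `R` (one may take the Ramsey number `R_k(k+1;(k+1)^m)`, or `2` in the degenerate cases)
such that: if a bounded `C ⊆ ℝ^V` has an `(S^k_+)^m`-lift and is `k`-neighborly with respect to a finite
`P ⊆ C`, then `|P| < R`. Proof as printed: the factorization theorem
(`HasBlockPsdLift.hasPsdPowerFactorization_slack`) writes the slacks `β_I − a_Iᵀx` (`I ∈ binom(P,k)`,
`x ∈ P`) as `Σ_t ⟨A_t(x), B_t(I)⟩` with psd `k × k` blocks, vanishing exactly when `x ∈ I`; apply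
`averkov_key_lemma`. [cite: Saunderson2019, Prop. 4.5 (p12)] [cite: Averkov2019, §4, proof of Thm. 2 via
Lemma 26 and Thm. 19 (p10–p12)] -/
theorem exists_card_lt_of_isNeighborlyWrt_of_hasBlockPsdLift (k m : ℕ) :
    ∃ R : ℕ, ∀ {V : Type u} [Fintype V] {C : Set (V → ℝ)}, Bornology.IsBounded C →
      HasBlockPsdLift C k m → ∀ P : Finset (V → ℝ), (↑P : Set (V → ℝ)) ⊆ C →
      IsNeighborlyWrt C k P → P.card < R := by
  obtain ⟨N, hN⟩ := averkov_key_lemma.{u} k m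
  refine ⟨max N 2, fun {V} _ C hCb hC P hPC hP => ?_⟩
  classical
  rcases Nat.eq_zero_or_pos k with hk | hk
  · -- `k = 0`: `C ⊆ {0}`, so `|P| ≤ 1`
    have hP1 : P.card ≤ 1 := card_le_one.2 fun x hx y hy => by
      have hx0 := hC.subset_zero_of_eq_zero (Or.inl hk) (hPC hx)
      have hy0 := hC.subset_zero_of_eq_zero (Or.inl hk) (hPC hy)
      rw [Set.mem_singleton_iff] at hx0 hy0
      rw [hx0, hy0]
    exact lt_of_le_of_lt hP1 (lt_of_lt_of_le one_lt_two (le_max_right _ _))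
  rcases Nat.eq_zero_or_pos m with hm | hm
  · have hP1 : P.card ≤ 1 := card_le_one.2 fun x hx y hy => by
      have hx0 := hC.subset_zero_of_eq_zero (Or.inr hm) (hPC hx)
      have hy0 := hC.subset_zero_of_eq_zero (Or.inr hm) (hPC hy)
      rw [Set.mem_singleton_iff] at hx0 hy0
      rw [hx0, hy0]
    exact lt_of_le_of_lt hP1 (lt_of_lt_of_le one_lt_two (le_max_right _ _))
  -- main case: factorize the slacks of the neighborliness inequalities
  refine lt_of_lt_of_le ?_ (le_max_left _ _)
  have hchoice : ∀ J : ↥(P.powersetCard k), ∃ aβ : (V → ℝ) × ℝ,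
      (∀ y ∈ C, aβ.1 ⬝ᵥ y ≤ aβ.2) ∧ ∀ x ∈ P, (aβ.1 ⬝ᵥ x = aβ.2 ↔ x ∈ (J : Finset (V → ℝ))) := by
    intro J
    obtain ⟨hJP, hJk⟩ := mem_powersetCard.1 J.2
    obtain ⟨a, β, hval, hex⟩ := hP J hJP hJk
    exact ⟨(a, β), hval, hex⟩
  choose aβ haβ using hchoice
  obtain ⟨A, B, hA, hB, hfac⟩ := hC.hasPsdPowerFactorization_slack (ι := ↥P) (J := ↥(P.powersetCard k))
    (x := fun i => (i : V → ℝ)) (a := fun J => (aβ J).1) (b := fun J => (aβ J).2) hk hm hCb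
    (fun i => hPC i.2) (fun y hy J => (haβ J).1 y hy)
  -- total extensions of the factor maps
  let a' : Finset (V → ℝ) → Fin m → Matrix (Fin k) (Fin k) ℝ := fun T t =>
    if hT : T ∈ P.powersetCard k then B ⟨T, hT⟩ t else 0
  let b' : (V → ℝ) → Fin m → Matrix (Fin k) (Fin k) ℝ := fun x t =>
    if hx : x ∈ P then A ⟨x, hx⟩ t else 0
  refine hN P a' b' (fun T hT t => by simp only [a', dif_pos hT]; exact hB _ t)
    (fun x hx t => by simp only [b', dif_pos hx]; exact hA _ t) fun T hT x hx => ?_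
  have hsum : ∑ t, (a' T t * b' x t).trace = (aβ ⟨T, hT⟩).2 - (aβ ⟨T, hT⟩).1 ⬝ᵥ x := by
    have hf := hfac ⟨x, hx⟩ ⟨T, hT⟩
    simp only at hf
    rw [hf]
    refine sum_congr rfl fun t _ => ?_
    simp only [a', b', dif_pos hT, dif_pos hx]
    exact Matrix.trace_mul_comm _ _
  rw [hsum, sub_eq_zero, eq_comm]
  exact (haβ ⟨T, hT⟩).2 x hx

/-- **Neighborliness obstructs lifts with small psd blocks** (Averkov 2019, the mechanism of Thm. 2;
Saunderson 2020 Thm. 1.4 for `K_1 = ⋯ = K_m = S^k_+`, `ℓ(S^k_+) = k+1`; FGPST 2022 Thm. 5.11 for products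
of psd cones: "if `m` is a positive integer and `C` is `k`-neighborly with respect to arbitrarily large
finite sets of extreme points then `C` does not have a `(S^k_+)^m`-lift"). Typed for a bounded set
`C ⊆ ℝ^V` and point sets `P ⊆ C` (neighborliness forces the points to be exposed, so "extreme points" is
automatic). The case `k = 2` is Fawzi's theorem, FGPST Thm. 5.10: a convex body `2`-neighborly with
respect to arbitrarily large finite point sets has no second-order-cone lift (`(S^2_+)^m`-lifts,
`posSemidef_lorentz_two_iff`). [cite: Averkov2019, Thm. 2 and §4 (p05, p10–p12)]
[cite: Saunderson2019, Thm. 1.4 (p04), Prop. 4.5 (p12)] [cite: FawziEtAl2022Lifting, Thm. 5.10, Thm. 5.11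
(§5.1.3, p25–p26)] -/
theorem not_hasBlockPsdLift_of_isNeighborlyWrt {V : Type u} [Fintype V] {C : Set (V → ℝ)}
    (hCb : Bornology.IsBounded C) {k m : ℕ}
    (hP : ∀ N : ℕ, ∃ P : Finset (V → ℝ), N ≤ P.card ∧ (↑P : Set (V → ℝ)) ⊆ C ∧ IsNeighborlyWrt C k P) :
    ¬ HasBlockPsdLift C k m := by
  intro hC
  obtain ⟨R, hR⟩ := exists_card_lt_of_isNeighborlyWrt_of_hasBlockPsdLift.{u} k m
  obtain ⟨P, hNP, hPC, hPn⟩ := hP R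
  exact absurd (hR hCb hC P hPC hPn) (not_lt.2 hNP)

/-! ### The spectraplex: Saunderson's Example 1.3 / FGPST Example 5.9, and Fawzi's theorem -/

namespace SpectraplexNeighborly

/-- Vectorisation `X ↦ (X_{ij})_{(i,j)}` of `n × n` matrices (coordinates `ℝ^{n × n}` for
`HasBlockPsdLift` / dot products). [folklore] -/
def vecLinear (n : ℕ) : Matrix (Fin n) (Fin n) ℝ →ₗ[ℝ] (Fin n × Fin n → ℝ) where
  toFun X p := X p.1 p.2
  map_add' _ _ := rfl
  map_smul' _ _ := rfl

/-- Unfolding of the vectorisation. [folklore] -/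
@[simp] private theorem vecLinear_apply (n : ℕ) (X : Matrix (Fin n) (Fin n) ℝ) (p : Fin n × Fin n) :
    vecLinear n X p = X p.1 p.2 := rfl

/-- The **spectraplex** `{X ⪰ 0, Tr X = 1}` of `n × n` real symmetric matrices in the coordinates
`ℝ^{n × n}` (the tree's `IsSpectraplex`, vectorised). [cite: FawziEtAl2022Lifting, Ex. 5.9 (p25, "the set
of `3 × 3` positive semidefinite matrices with trace one, sometimes called the `3 × 3` spectraplex")] -/
def spectraplexFlat (n : ℕ) : Set (Fin n × Fin n → ℝ) :=
  {x | Literature.Combinatorics.SimpleGraph.IsSpectraplex (Matrix.of fun i j => x (i, j))}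

/-- Membership in the vectorised spectraplex: `X ⪰ 0` and `Tr X = 1` for the matrix `X` of `x`.
[cite: FawziEtAl2022Lifting, Ex. 5.9 (p25)] -/
theorem mem_spectraplexFlat_iff {n : ℕ} (x : Fin n × Fin n → ℝ) :
    x ∈ spectraplexFlat n ↔ (Matrix.of fun i j => x (i, j)).PosSemidef ∧
      (Matrix.of fun i j => x (i, j)).trace = 1 :=
  ⟨fun h => ⟨h.posSemidef, h.trace_eq_one⟩, fun h => ⟨h.1, h.2⟩⟩

/-- The vectorised spectraplex is the image of the matrix spectraplex under the vectorisation.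
[cite: FawziEtAl2022Lifting, Ex. 5.9 (p25)] -/
theorem vecLinear_image_spectraplex (n : ℕ) :
    vecLinear n '' {B : Matrix (Fin n) (Fin n) ℝ | Literature.Combinatorics.SimpleGraph.IsSpectraplex B} =
      spectraplexFlat n := by
  ext x
  constructor
  · rintro ⟨B, hB, rfl⟩
    have hBe : (Matrix.of fun i j => vecLinear n B (i, j)) = B := by
      ext i j; rfl
    change Literature.Combinatorics.SimpleGraph.IsSpectraplex _
    rw [hBe]; exact hB
  · intro hx
    exact ⟨Matrix.of fun i j => x (i, j), hx, by ext p; rfl⟩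

/-- The spectraplex is bounded (`|X_{ij}| ≤ 1`, `IsSpectraplex.abs_apply_le_one`) — it is a convex body,
as Thm. 5.10/5.11 require. [cite: FawziEtAl2022Lifting, Ex. 5.9 with Def. 5.8 (p25, "a convex body")] -/
theorem isBounded_spectraplexFlat (n : ℕ) : Bornology.IsBounded (spectraplexFlat n) := by
  rw [isBounded_iff_forall_norm_le]
  refine ⟨1, fun x hx => ?_⟩
  refine (pi_norm_le_iff_of_nonneg zero_le_one).2 fun p => ?_
  rw [Real.norm_eq_abs]
  have h := Literature.Combinatorics.SimpleGraph.IsSpectraplex.abs_apply_le_one hx p.1 p.2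
  simpa using h

/-- The moment vector `v_t = (1, t, t², …, t^{n-1})`. [cite: Saunderson2019, Ex. 1.3 (p04)] -/
def momentVec (n t : ℕ) : Fin n → ℝ := fun j => (t : ℝ) ^ (j : ℕ)

/-- `|v_t|² = Σ_j t^{2j}`. [cite: Saunderson2019, Ex. 1.3 (p04, the normalisation `‖v_i‖²`)] -/
theorem momentVec_dotProduct_self (n t : ℕ) :
    momentVec n t ⬝ᵥ momentVec n t = ∑ j : Fin n, (t : ℝ) ^ (2 * (j : ℕ)) := by
  simp only [dotProduct, momentVec, ← pow_add, two_mul]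

/-- `|v_t|² > 0` (the first coordinate of `v_t` is `1`). [cite: Saunderson2019, Ex. 1.3 (p04)] -/
theorem momentVec_dotProduct_self_pos {n : ℕ} (hn : 1 ≤ n) (t : ℕ) :
    0 < momentVec n t ⬝ᵥ momentVec n t := by
  rw [momentVec_dotProduct_self]
  have h0 : (0 : ℝ) < (t : ℝ) ^ (2 * ((⟨0, hn⟩ : Fin n) : ℕ)) := by simp
  exact lt_of_lt_of_le h0 (single_le_sum (f := fun j : Fin n => (t : ℝ) ^ (2 * (j : ℕ)))
    (fun j _ => by positivity) (mem_univ _))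

/-- `|v_t|²` is strictly increasing in `t ∈ ℕ` once `n ≥ 2` (the term `t²` is present), so the points
`v_tv_tᵀ/‖v_t‖²` are pairwise distinct. [cite: Saunderson2019, Ex. 1.3 (p04)] -/
theorem momentVec_dotProduct_self_strictMono {n : ℕ} (hn : 2 ≤ n) :
    StrictMono fun t : ℕ => momentVec n t ⬝ᵥ momentVec n t := by
  intro t t' htt'
  have hle : (t : ℝ) ≤ t' := by exact_mod_cast htt'.le
  have hlt : (t : ℝ) < t' := by exact_mod_cast htt'
  simp only [momentVec_dotProduct_self]
  refine sum_lt_sum (fun j _ => pow_le_pow_left₀ (Nat.cast_nonneg t) hle _) ⟨⟨1, hn⟩, mem_univ _, ?_⟩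
  exact pow_lt_pow_left₀ hlt (Nat.cast_nonneg t) (by norm_num)

/-- The rank-one points `x_t = v_t v_tᵀ / |v_t|²` of the spectraplex, vectorised.
[cite: Saunderson2019, Ex. 1.3 (p04)] [cite: FawziEtAl2022Lifting, Ex. 5.9 (p25)] -/
def momentPoint (n t : ℕ) : Fin n × Fin n → ℝ :=
  fun p => momentVec n t p.1 * momentVec n t p.2 / (momentVec n t ⬝ᵥ momentVec n t)

/-- As a matrix, `x_t = ‖v_t‖⁻² · v_t v_tᵀ`. [cite: Saunderson2019, Ex. 1.3 (p04)] -/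
theorem of_momentPoint (n t : ℕ) :
    (Matrix.of fun i j => momentPoint n t (i, j)) =
      (momentVec n t ⬝ᵥ momentVec n t)⁻¹ • vecMulVec (momentVec n t) (momentVec n t) := by
  ext i j
  simp [momentPoint, vecMulVec_apply, div_eq_inv_mul]

/-- `x_t` lies in the spectraplex (`n ≥ 1`). [cite: Saunderson2019, Ex. 1.3 (p04)] -/
theorem momentPoint_mem_spectraplexFlat {n : ℕ} (hn : 1 ≤ n) (t : ℕ) :
    momentPoint n t ∈ spectraplexFlat n := by
  have hpos := momentVec_dotProduct_self_pos hn t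
  rw [mem_spectraplexFlat_iff, of_momentPoint]
  refine ⟨?_, ?_⟩
  · have h := posSemidef_vecMulVec_self_star (momentVec n t)
    rw [star_trivial] at h
    exact h.smul (inv_nonneg.2 hpos.le)
  · rw [trace_smul, trace_vecMulVec, smul_eq_mul, inv_mul_cancel₀ hpos.ne']

/-- `t ↦ x_t` is injective on `ℕ` for `n ≥ 2` (read off the `(0,0)` entry `1/‖v_t‖²`), so
`V = {v_iv_iᵀ/‖v_i‖² : i ∈ ℕ}` is infinite. [cite: Saunderson2019, Ex. 1.3 (p04)] -/
theorem momentPoint_injective {n : ℕ} (hn : 2 ≤ n) : Function.Injective (momentPoint n) := by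
  intro t t' h
  have h00 := congrFun h (⟨0, by omega⟩, ⟨0, by omega⟩)
  simp only [momentPoint, momentVec, pow_zero, mul_one, one_div] at h00
  exact (momentVec_dotProduct_self_strictMono hn).injective (inv_injective h00)

/-- The first `N` moment points `{x_0, …, x_{N-1}}`. [cite: Saunderson2019, Ex. 1.3 (p04)] -/
def momentPoints (n N : ℕ) : Finset (Fin n × Fin n → ℝ) := (Finset.range N).image (momentPoint n)

/-- There are `N` distinct points `x_0, …, x_{N-1}` (`n ≥ 2`): arbitrarily large finite subsets of
`V = {v_iv_iᵀ/‖v_i‖²}`. [cite: Saunderson2019, Ex. 1.3 and remark after Thm. 1.4 (p04)] -/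
theorem card_momentPoints {n : ℕ} (hn : 2 ≤ n) (N : ℕ) : (momentPoints n N).card = N := by
  classical
  rw [momentPoints, card_image_of_injective _ (momentPoint_injective hn), card_range]

/-- The moment points lie in the spectraplex. [cite: Saunderson2019, Ex. 1.3 (p04)]
[cite: FawziEtAl2022Lifting, Ex. 5.9 (p25)] -/
theorem momentPoints_subset_spectraplexFlat {n : ℕ} (hn : 1 ≤ n) (N : ℕ) :
    (↑(momentPoints n N) : Set (Fin n × Fin n → ℝ)) ⊆ spectraplexFlat n := by
  intro x hx
  obtain ⟨t, -, rfl⟩ := mem_image.1 (mem_coe.1 hx)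
  exact momentPoint_mem_spectraplexFlat hn t

/-- The quadratic functional `x ↦ Σ_{ij} c_i c_j x_{ij} = cᵀ X c = tr(ccᵀ X)` in the coordinates
`ℝ^{n×n}`. [cite: Saunderson2019, Ex. 1.3 (p04, `tr(c(W)c(W)ᵀ v_tv_tᵀ)`)] -/
theorem dotProduct_vecOuter_eq {n : ℕ} (c : Fin n → ℝ) (x : Fin n × Fin n → ℝ) :
    (fun p : Fin n × Fin n => c p.1 * c p.2) ⬝ᵥ x =
      c ⬝ᵥ ((Matrix.of fun i j => x (i, j)) *ᵥ c) := by
  simp only [dotProduct, Fintype.sum_prod_type, mulVec, Matrix.of_apply, mul_sum]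
  refine sum_congr rfl fun i _ => sum_congr rfl fun j _ => ?_
  ring

/-- At a moment point, `cᵀ x_t c = (cᵀ v_t)² / ‖v_t‖²` ("`p_W(t) = (Σ_j c(W)_j t^j)² =
tr(c(W)c(W)ᵀ v_tv_tᵀ)`"). [cite: Saunderson2019, Ex. 1.3 (p04)] -/
theorem dotProduct_vecOuter_momentPoint {n : ℕ} (c : Fin n → ℝ) (t : ℕ) :
    (fun p : Fin n × Fin n => c p.1 * c p.2) ⬝ᵥ momentPoint n t =
      (c ⬝ᵥ momentVec n t) ^ 2 / (momentVec n t ⬝ᵥ momentVec n t) := by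
  simp only [dotProduct, Fintype.sum_prod_type, momentPoint]
  rw [sq, sum_mul_sum, sum_div]
  refine sum_congr rfl fun i _ => ?_
  rw [sum_div]
  refine sum_congr rfl fun j _ => ?_
  ring

/-- `cᵀ v_t = p(t)` for the coefficient vector `c` of a polynomial `p` of degree `< n`.
[cite: Saunderson2019, Ex. 1.3 (p04, "`p_W(t) = (Σ_j c(W)_j t^j)²`")] -/
theorem coeff_dotProduct_momentVec {n : ℕ} (p : Polynomial ℝ) (hp : p.natDegree < n) (t : ℕ) :
    (fun j : Fin n => p.coeff j) ⬝ᵥ momentVec n t = p.eval (t : ℝ) := by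
  rw [Polynomial.eval_eq_sum_range' hp, dotProduct]
  simp only [momentVec]
  exact (Fin.sum_univ_eq_sum_range (fun j => p.coeff j * (t : ℝ) ^ j) n)

/-- **The `(k+1) × (k+1)` spectraplex is `k`-neighborly with respect to the moment points**
(Saunderson Ex. 1.3: "The cone of `(k+1) × (k+1)` positive semidefinite symmetric matrices is
`k`-neighborly with respect to `V = {v_iv_iᵀ/‖v_i‖² : i ∈ ℕ}` where `v_i := (1, i, i², …, i^k)`", via
`p_W(t) = [Π_{i∈W}(t − i)]² = tr(c(W)c(W)ᵀ v_tv_tᵀ)`, which "vanishes if and only if `t ∈ W`"; FGPST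
Ex. 5.9 for `k = 2`). The valid inequality used for the `k`-set `I = {x_t : t ∈ W}` is `−cᵀXc ≤ 0`.
[cite: Saunderson2019, Ex. 1.3 (p04)] [cite: FawziEtAl2022Lifting, Ex. 5.9 (p25)] -/
theorem isNeighborlyWrt_spectraplexFlat_momentPoints (k N : ℕ) :
    IsNeighborlyWrt (spectraplexFlat (k + 1)) k (momentPoints (k + 1) N) := by
  classical
  intro I hI hIk
  -- the parameters `W` of the points of `I`
  set W : Finset ℕ := (Finset.range N).filter fun t => momentPoint (k + 1) t ∈ I with hW
  have hIW : I = W.image (momentPoint (k + 1)) := by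
    ext x
    simp only [hW, mem_image, mem_filter]
    constructor
    · intro hx
      obtain ⟨t, ht, rfl⟩ := mem_image.1 (hI hx)
      exact ⟨t, ⟨ht, hx⟩, rfl⟩
    · rintro ⟨t, ⟨-, ht⟩, rfl⟩
      exact ht
  have hWcard : W.card ≤ k := by
    rcases Nat.lt_or_ge k 1 with hk | hk
    · -- `k = 0`: `I = ∅`, hence `W = ∅`
      have hI0 : I = ∅ := card_eq_zero.1 (by omega)
      have : W = ∅ := by
        rw [hW]
        refine filter_eq_empty_iff.2 fun t _ => ?_
        rw [hI0]; exact notMem_empty _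
      rw [this, card_empty]; exact Nat.zero_le _
    · have hinj := momentPoint_injective (n := k + 1) (by omega)
      rw [← hIk, hIW, card_image_of_injective _ hinj]
  -- the polynomial `Π_{t ∈ W} (x - t)` and its coefficient vector
  set p : Polynomial ℝ := ∏ t ∈ W, (Polynomial.X - Polynomial.C (t : ℝ)) with hp
  have hpdeg : p.natDegree < k + 1 := by
    rw [hp, Polynomial.natDegree_finsetProd_X_sub_C_eq_card]
    omega
  set c : Fin (k + 1) → ℝ := fun j => p.coeff j with hc
  have heval : ∀ t : ℕ, c ⬝ᵥ momentVec (k + 1) t = ∏ s ∈ W, ((t : ℝ) - s) := by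
    intro t
    rw [hc, coeff_dotProduct_momentVec p hpdeg t, hp, Polynomial.eval_prod]
    simp only [Polynomial.eval_sub, Polynomial.eval_X, Polynomial.eval_C]
  have heval0 : ∀ t : ℕ, c ⬝ᵥ momentVec (k + 1) t = 0 ↔ t ∈ W := by
    intro t
    rw [heval t, prod_eq_zero_iff]
    constructor
    · rintro ⟨s, hs, h⟩
      have : (t : ℝ) = s := sub_eq_zero.1 h
      have hts : t = s := by exact_mod_cast this
      rwa [hts]
    · intro ht
      exact ⟨t, ht, sub_self _⟩
  refine ⟨fun q => -(c q.1 * c q.2), 0, fun y hy => ?_, fun x hx => ?_⟩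
  · -- validity: `−cᵀ Y c ≤ 0` for `Y ⪰ 0`
    have hpsd := ((mem_spectraplexFlat_iff y).1 hy).1
    have h := hpsd.dotProduct_mulVec_nonneg c
    rw [star_trivial, ← dotProduct_vecOuter_eq] at h
    have hneg : (fun q : Fin (k + 1) × Fin (k + 1) => -(c q.1 * c q.2)) ⬝ᵥ y =
        -((fun q : Fin (k + 1) × Fin (k + 1) => c q.1 * c q.2) ⬝ᵥ y) := by
      rw [← neg_dotProduct]; rfl
    rw [hneg]
    linarith
  · -- exactness on the moment points
    obtain ⟨t, htN, rfl⟩ := mem_image.1 hx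
    have hneg : (fun q : Fin (k + 1) × Fin (k + 1) => -(c q.1 * c q.2)) ⬝ᵥ momentPoint (k + 1) t =
        -((fun q : Fin (k + 1) × Fin (k + 1) => c q.1 * c q.2) ⬝ᵥ momentPoint (k + 1) t) := by
      rw [← neg_dotProduct]; rfl
    rw [hneg, neg_eq_zero, dotProduct_vecOuter_momentPoint, div_eq_zero_iff, sq_eq_zero_iff, heval0 t,
      or_iff_left (momentVec_dotProduct_self_pos (Nat.succ_pos k) t).ne']
    simp only [hW, mem_filter, mem_range]
    exact ⟨fun h => h.2, fun h => ⟨mem_range.1 htN, h⟩⟩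

/-- The unit-trace hyperplane `{B : Tr B = 1}` as an affine subspace. [folklore] -/
def traceOneAffineSubspace (n : ℕ) : AffineSubspace ℝ (Matrix (Fin n) (Fin n) ℝ) where
  carrier := {B | B.trace = 1}
  smul_vsub_vadd_mem' c p₁ p₂ p₃ h₁ h₂ h₃ := by
    simp only [Set.mem_setOf_eq, vsub_eq_sub, vadd_eq_add, trace_add, trace_smul, trace_sub,
      smul_eq_mul] at *
    rw [h₁, h₂, h₃]; ring


/-- The spectraplex is the unit-trace section of the psd cone. [cite: FawziEtAl2022Lifting, Ex. 5.9 (p25)] -/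
theorem posSemidef_inter_traceOne_eq (n : ℕ) :
    {B : Matrix (Fin n) (Fin n) ℝ | B.PosSemidef} ∩
        (traceOneAffineSubspace n : Set (Matrix (Fin n) (Fin n) ℝ)) =
      {B | Literature.Combinatorics.SimpleGraph.IsSpectraplex B} := by
  ext B
  exact ⟨fun hB => ⟨hB.1, hB.2⟩, fun hB => ⟨hB.posSemidef, hB.trace_eq_one⟩⟩

/-- `S^n_+` has the identity `(S^n_+)^1`-lift. [cite: Averkov2019, Def. 1 (p03, "`S` has a `S^k_+`-lift")] -/
theorem hasBlockPsdLift_posSemidef_self (n : ℕ) :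
    HasBlockPsdLift {B : Matrix (Fin n) (Fin n) ℝ | B.PosSemidef} n 1 := by
  refine ⟨⊤, LinearMap.proj 0, ?_⟩
  ext B
  constructor
  · intro hB
    exact ⟨fun _ => B, ⟨fun _ => hB, AffineSubspace.mem_top ℝ _ _⟩, rfl⟩
  · rintro ⟨M, ⟨hM, -⟩, rfl⟩
    exact hM 0

/-- The spectraplex has an `(S^n_+)^1`-lift (a section of the identity lift of `S^n_+`).
[cite: FawziEtAl2022Lifting, Ex. 5.9 (p25)] -/
theorem hasBlockPsdLift_spectraplex_self (n : ℕ) :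
    HasBlockPsdLift {B : Matrix (Fin n) (Fin n) ℝ | Literature.Combinatorics.SimpleGraph.IsSpectraplex B}
      n 1 := by
  rw [← posSemidef_inter_traceOne_eq]
  exact (hasBlockPsdLift_posSemidef_self n).inter_affineSubspace _

end SpectraplexNeighborly

open SpectraplexNeighborly

/-- **The `(k+1) × (k+1)` spectraplex has no `(S^k_+)^m`-lift, for any `m`** (vectorised form):
Averkov's obstruction applied to the moment points; `k = 2`: the `3 × 3` spectraplex has no
second-order-cone lift (FGPST after Thm. 5.10). For `k = 0` the lifted sets are `⊆ {0}`.
[cite: Averkov2019, Thm. 2 with Cor. (sxdeg `S^{k}_+ = k`) (p05)] [cite: Saunderson2019, Ex. 1.3 + Thm. 1.4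
(p04)] [cite: FawziEtAl2022Lifting, Ex. 5.9 and Thm. 5.10 (p25)] -/
theorem not_hasBlockPsdLift_spectraplexFlat (k m : ℕ) :
    ¬ HasBlockPsdLift (spectraplexFlat (k + 1)) k m := by
  rcases Nat.eq_zero_or_pos k with rfl | hk
  · intro h
    have h0 := h.subset_zero_of_eq_zero (Or.inl rfl)
      (momentPoint_mem_spectraplexFlat (le_refl 1) 1)
    have hval : momentPoint 1 1 (0, 0) = 1 := by
      simp [momentPoint, momentVec, dotProduct]
    rw [Set.mem_singleton_iff.1 h0] at hval
    exact zero_ne_one hval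
  · refine not_hasBlockPsdLift_of_isNeighborlyWrt (isBounded_spectraplexFlat (k + 1)) fun N =>
      ⟨momentPoints (k + 1) N, (card_momentPoints (by omega) N).ge,
        momentPoints_subset_spectraplexFlat (Nat.succ_pos k) N,
        isNeighborlyWrt_spectraplexFlat_momentPoints k N⟩

/-- **The `(k+1) × (k+1)` spectraplex `{B ⪰ 0, Tr B = 1}` has no `(S^k_+)^m`-lift, for any `m`**
(matrix form; a lift would push forward along the vectorisation `vecLinear`).
[cite: Averkov2019, Thm. 2 (p05)] [cite: Saunderson2019, Ex. 1.3, Thm. 1.4 (p04)]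
[cite: FawziEtAl2022Lifting, Ex. 5.9, Thm. 5.10 (p25)] -/
theorem not_hasBlockPsdLift_spectraplex (k m : ℕ) :
    ¬ HasBlockPsdLift {B : Matrix (Fin (k + 1)) (Fin (k + 1)) ℝ |
        Literature.Combinatorics.SimpleGraph.IsSpectraplex B} k m := by
  intro h
  have h' := h.image (vecLinear (k + 1))
  rw [vecLinear_image_spectraplex] at h'
  exact not_hasBlockPsdLift_spectraplexFlat k m h'

/-- **The psd cone `S^{k+1}_+` has no `(S^k_+)^m`-lift, for any `m`** (Averkov 2019: the semidefinite
extension degree of `S^{k+1}_+` is `k+1`; `k = 2` is **Fawzi's Theorem 1**: "The cone `S^3_+` does not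
admit any `SOC^k`-lift for any finite `k`", second-order cones being linearly isomorphic to `S^2_+`,
`posSemidef_lorentz_two_iff`). Homogenisation as in FGPST after Thm. 5.10: a lift of the cone would
restrict to a lift of its unit-trace section, the spectraplex (`HasBlockPsdLift.inter_affineSubspace`).
[cite: Fawzi2016, Thm. 1 (p03)] [cite: Averkov2019, Thm. 2 and Thm. 8 (p05)]
[cite: FawziEtAl2022Lifting, after Thm. 5.10 (p25, "It follows (by a homogenization argument) that `S^3_+`
does not have a second-order cone lift")] -/
theorem not_hasBlockPsdLift_posSemidef (k m : ℕ) :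
    ¬ HasBlockPsdLift {B : Matrix (Fin (k + 1)) (Fin (k + 1)) ℝ | B.PosSemidef} k m := by
  intro h
  have h' := h.inter_affineSubspace (traceOneAffineSubspace (k + 1))
  rw [posSemidef_inter_traceOne_eq] at h'
  exact not_hasBlockPsdLift_spectraplex k m h'

/-- **FGPST Theorem 5.10 (Fawzi): `2`-neighborliness with respect to arbitrarily large finite point sets
obstructs second-order-cone lifts**, i.e. `(S^2_+)^m`-lifts for every `m` ("Recall that these are
`K`-lifts in which `K` is a finite Cartesian product of second-order cones"; `S^2_+ ≅ L^3_+`,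
`posSemidef_lorentz_two_iff`) — the case `k = 2` of `not_hasBlockPsdLift_of_isNeighborlyWrt`.
[cite: FawziEtAl2022Lifting, Thm. 5.10 (§5.1.3, p25)] [cite: Fawzi2016, Thm. 1 and §2 (p03–p04)] -/
theorem not_hasBlockPsdLift_two_of_isNeighborlyWrt {V : Type u} [Fintype V] {C : Set (V → ℝ)}
    (hCb : Bornology.IsBounded C)
    (hP : ∀ N : ℕ, ∃ P : Finset (V → ℝ), N ≤ P.card ∧ (↑P : Set (V → ℝ)) ⊆ C ∧ IsNeighborlyWrt C 2 P)
    (m : ℕ) : ¬ HasBlockPsdLift C 2 m :=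
  not_hasBlockPsdLift_of_isNeighborlyWrt hCb hP

/-! ### Averkov's semidefinite extension degree of `S^{k+1}_+` (Corollary 6) -/

/-- **Averkov 2019, Corollary 6: `sxd(S^k_+) = k`.** With Averkov's Definition 1 ("the semidefinite
extension degree `sxd(S)` of `S` [is] the smallest `k` such that `S` has an `(S^k_+)^m`-lift for some
finite `m`"): the least block size `d` for which `S^{k+1}_+` has an `(S^d_+)^m`-lift for some `m` is
`k + 1` — the identity lift gives `d = k+1`, and `d ≤ k` is excluded by `not_hasBlockPsdLift_posSemidef`
with the monotonicity `(S^d_+)^m ↪ (S^k_+)^m` (`HasBlockPsdLift.mono_size`).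
[cite: Averkov2019, Def. 1 (p03) and Cor. 6 (p05)] [cite: Fawzi2016, Thm. 1 (p03)] -/
theorem isLeast_blockSize_hasBlockPsdLift_posSemidef (k : ℕ) :
    IsLeast {d : ℕ | ∃ m : ℕ,
      HasBlockPsdLift {B : Matrix (Fin (k + 1)) (Fin (k + 1)) ℝ | B.PosSemidef} d m} (k + 1) := by
  refine ⟨⟨1, hasBlockPsdLift_posSemidef_self (k + 1)⟩, fun d hd => ?_⟩
  obtain ⟨m, hm⟩ := hd
  by_contra hlt
  exact not_hasBlockPsdLift_posSemidef k m (hm.mono_size (by omega))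

/-- The same for the spectraplex: the least block size `d` with an `(S^d_+)^m`-lift of the
`(k+1) × (k+1)` spectraplex (some `m`) is `k + 1`. [cite: Averkov2019, Def. 1 (p03), Cor. 6 (p05)]
[cite: FawziEtAl2022Lifting, Ex. 5.9 with Thm. 5.10–5.11 (p25–p26)] -/
theorem isLeast_blockSize_hasBlockPsdLift_spectraplex (k : ℕ) :
    IsLeast {d : ℕ | ∃ m : ℕ, HasBlockPsdLift {B : Matrix (Fin (k + 1)) (Fin (k + 1)) ℝ |
      Literature.Combinatorics.SimpleGraph.IsSpectraplex B} d m} (k + 1) := by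
  refine ⟨⟨1, hasBlockPsdLift_spectraplex_self (k + 1)⟩, fun d hd => ?_⟩
  obtain ⟨m, hm⟩ := hd
  by_contra hlt
  exact not_hasBlockPsdLift_spectraplex k m (hm.mono_size (by omega))

/-! ### Second-order cones are `(S^2_+)`-block cones: `L^{ℓ+1}_+` has an `(S^2_+)^ℓ`-lift -/

section SecondOrderCone

open Literature.Analysis.Convex.SecondOrderConePrograms (soc mk_mem_soc_iff)

/-- Off-diagonal entries of a real psd matrix: `M_{ij}² ≤ M_{ii} M_{jj}` (the principal `2 × 2` minor
is nonnegative). [folklore] -/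
private theorem sq_apply_le_mul_diag_of_posSemidef {n : Type*} [Fintype n] [DecidableEq n]
    {M : Matrix n n ℝ} (hM : M.PosSemidef) (i j : n) : M i j ^ 2 ≤ M i i * M j j := by
  have h := (hM.submatrix ![i, j]).det_nonneg
  rw [Matrix.det_fin_two] at h
  have hsym : M j i = M i j := by
    simpa [conjTranspose_apply] using congrFun (congrFun hM.1 i) j
  simp only [Matrix.submatrix_apply, Matrix.cons_val_zero, Matrix.cons_val_one] at h
  rw [hsym] at h
  rw [sq]
  linarith

/-- The `2 × 2` block `[[y, x], [x, t]]` is psd when `0 ≤ y`, `0 ≤ t` and `x² ≤ y t`. [folklore] -/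
private theorem posSemidef_two_of_sq_le (y x t : ℝ) (hy : 0 ≤ y) (ht : 0 ≤ t) (hxt : x ^ 2 ≤ y * t) :
    (!![y, x; x, t] : Matrix (Fin 2) (Fin 2) ℝ).PosSemidef := by
  refine PosSemidef.of_dotProduct_mulVec_nonneg
    (Matrix.IsHermitian.ext fun i j => by fin_cases i <;> fin_cases j <;> simp) fun v => ?_
  have hquad : star v ⬝ᵥ ((!![y, x; x, t] : Matrix (Fin 2) (Fin 2) ℝ) *ᵥ v) =
      y * v 0 * v 0 + 2 * x * v 0 * v 1 + t * v 1 * v 1 := by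
    simp [Matrix.mulVec, dotProduct, Fin.sum_univ_two]
    ring
  rw [hquad]
  rcases hy.lt_or_eq with hy' | hy'
  · -- `y · q(v) = (y v₀ + x v₁)² + (y t − x²) v₁² ≥ 0`
    have h1 : 0 ≤ (y * v 0 + x * v 1) ^ 2 + (y * t - x ^ 2) * v 1 ^ 2 := by
      have := sq_nonneg (y * v 0 + x * v 1)
      have := mul_nonneg (sub_nonneg.2 hxt) (sq_nonneg (v 1))
      linarith
    have h2 : y * (y * v 0 * v 0 + 2 * x * v 0 * v 1 + t * v 1 * v 1) =
        (y * v 0 + x * v 1) ^ 2 + (y * t - x ^ 2) * v 1 ^ 2 := by ring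
    have h3 : 0 ≤ y * (y * v 0 * v 0 + 2 * x * v 0 * v 1 + t * v 1 * v 1) := by rw [h2]; exact h1
    exact le_of_mul_le_mul_left (by rw [mul_zero]; exact h3) hy'
  · -- `y = 0` forces `x = 0`
    subst hy'
    have hx : x = 0 := by nlinarith [sq_nonneg x]
    subst hx
    nlinarith [mul_nonneg ht (sq_nonneg (v 1))]

/-- **"The second order cone `L^{ℓ+1}_+` has a `(S^2_+)^ℓ`-lift"** (FGPST, after Thm. 5.10; the tower
of `2 × 2` blocks `[[y_i, x_i], [x_i, t]] ⪰ 0`, `Σ_i y_i = t`, of Ben-Tal–Nemirovski type: `x_i² ≤ y_i t` and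
`Σ y_i = t` give `‖x‖² ≤ t²`; conversely `y_i = x_i²/t + (t − ‖x‖²/t)/ℓ`). Hence second-order-cone
lifts (lifts by finite products of cones `L^{ℓ+1}_+`) are `(S^2_+)^m`-lifts, the class obstructed by
`2`-neighborliness (`not_hasBlockPsdLift_two_of_isNeighborlyWrt`); the converse inclusion `S^2_+ ≅ L^3_+`
is `posSemidef_lorentz_two_iff`. Typed over the tree's cone `soc V = {(t, u) : ‖u‖ ≤ t}` with
`V = ℝ^ℓ` Euclidean, `ℓ ≥ 1`. [cite: FawziEtAl2022Lifting, §5.1.3, remark after Thm. 5.10 (p25)]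
[cite: Averkov2019, Prop. 7 (p05, `sxd ≤ 2` ⇔ `(L_3)^m`-lift ⇔ `L_m`-lift) with Lemma 39 (Ben-Tal–Nemirovski)] -/
theorem hasBlockPsdLift_soc {ℓ : ℕ} (hℓ : 1 ≤ ℓ) :
    HasBlockPsdLift (soc (EuclideanSpace ℝ (Fin ℓ))) 2 ℓ := by
  classical
  set i₀ : Fin ℓ := ⟨0, hℓ⟩ with hi₀
  let e := EuclideanSpace.equiv (Fin ℓ) ℝ
  -- the linear slice: common `(1,1)` entry `t`, and `Σ_i (0,0)` entries `= t`
  let Lsub : Submodule ℝ (Fin ℓ → Matrix (Fin 2) (Fin 2) ℝ) :=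
    { carrier := {M | (∀ i, M i 1 1 = M i₀ 1 1) ∧ ∑ i, M i 0 0 = M i₀ 1 1}
      add_mem' := by
        rintro M N ⟨hM1, hM2⟩ ⟨hN1, hN2⟩
        refine ⟨fun i => ?_, ?_⟩
        · simp only [Pi.add_apply, Matrix.add_apply, hM1 i, hN1 i]
        · simp only [Pi.add_apply, Matrix.add_apply, sum_add_distrib, hM2, hN2]
      zero_mem' := by
        refine ⟨fun i => rfl, ?_⟩
        simp
      smul_mem' := by
        rintro c M ⟨hM1, hM2⟩
        refine ⟨fun i => ?_, ?_⟩
        · simp only [Pi.smul_apply, Matrix.smul_apply, hM1 i]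
        · simp only [Pi.smul_apply, Matrix.smul_apply, smul_eq_mul, ← mul_sum, hM2] }
  let π : (Fin ℓ → Matrix (Fin 2) (Fin 2) ℝ) →ₗ[ℝ] ℝ × EuclideanSpace ℝ (Fin ℓ) :=
    { toFun := fun M => (M i₀ 1 1, e.symm fun i => M i 0 1)
      map_add' := fun M N => by
        refine Prod.ext rfl ?_
        change e.symm _ = e.symm _ + e.symm _
        rw [← map_add]
        rfl
      map_smul' := fun c M => by
        refine Prod.ext rfl ?_
        change e.symm _ = c • e.symm _
        rw [← map_smul]
        rfl }
  refine ⟨Lsub.toAffineSubspace, π, ?_⟩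
  ext ⟨t, x⟩
  rw [mk_mem_soc_iff]
  constructor
  · -- `‖x‖ ≤ t` ⇒ a preimage in the slice
    intro hxt
    have ht : 0 ≤ t := (norm_nonneg x).trans hxt
    have hsq : ∑ i, x i ^ 2 ≤ t ^ 2 := by
      rw [← EuclideanSpace.real_norm_sq_eq]
      exact pow_le_pow_left₀ (norm_nonneg x) hxt 2
    -- the diagonal entries `y_i`
    let y : Fin ℓ → ℝ := fun i => if t = 0 then 0 else x i ^ 2 / t + (t - (∑ j, x j ^ 2) / t) / ℓ
    have hℓ0 : (ℓ : ℝ) ≠ 0 := by exact_mod_cast (Nat.one_le_iff_ne_zero.1 hℓ)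
    have hy : ∀ i, 0 ≤ y i ∧ x i ^ 2 ≤ y i * t := by
      intro i
      by_cases h0 : t = 0
      · have hx0 : x i = 0 := by
          have hle : x i ^ 2 ≤ ∑ j, x j ^ 2 :=
            single_le_sum (f := fun j => x j ^ 2) (fun j _ => sq_nonneg _) (mem_univ i)
          rw [h0] at hsq
          nlinarith [sq_nonneg (x i)]
        simp [y, h0, hx0]
      · have htpos : 0 < t := lt_of_le_of_ne ht (Ne.symm h0)
        have hslack : 0 ≤ t - (∑ j, x j ^ 2) / t := by
          rw [sub_nonneg, div_le_iff₀ htpos]; nlinarith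
        have hyi : y i = x i ^ 2 / t + (t - (∑ j, x j ^ 2) / t) / ℓ := by simp [y, h0]
        refine ⟨?_, ?_⟩
        · rw [hyi]; positivity
        · rw [hyi, add_mul, div_mul_cancel₀ _ h0]
          have : 0 ≤ (t - (∑ j, x j ^ 2) / t) / ℓ * t := by positivity
          linarith
    have hysum : ∑ i, y i = t := by
      by_cases h0 : t = 0
      · simp [y, h0]
      · simp only [y, h0, if_false, sum_add_distrib, sum_const, card_univ, Fintype.card_fin,
          nsmul_eq_mul]
        rw [← sum_div, mul_div_cancel₀ _ hℓ0]
        field_simp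
        ring
    refine ⟨fun i => !![y i, x i; x i, t], ⟨⟨fun i => ?_, ?_⟩, ?_⟩⟩
    · exact posSemidef_two_of_sq_le _ _ _ (hy i).1 ht (hy i).2
    · change (∀ i, _ = _) ∧ _
      constructor
      · intro i
        simp
      · simpa using hysum
    · refine Prod.ext ?_ ?_
      · simp [π]
      · change e.symm (fun i => (!![y i, x i; x i, t] : Matrix (Fin 2) (Fin 2) ℝ) 0 1) = x
        have : (fun i => (!![y i, x i; x i, t] : Matrix (Fin 2) (Fin 2) ℝ) 0 1) = WithLp.ofLp x := by
          funext i
          simp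
        rw [this]
        exact e.symm_apply_apply x
  · -- a point of the slice projects into the cone
    rintro ⟨M, ⟨hpsd, hL⟩, hπ⟩
    change ((∀ i, M i 1 1 = M i₀ 1 1) ∧ ∑ i, M i 0 0 = M i₀ 1 1) at hL
    obtain ⟨hL1, hL2⟩ := hL
    have ht : M i₀ 1 1 = t := congrArg Prod.fst hπ
    have hx : ∀ i, M i 0 1 = x i := fun i => by
      have h2 := congrArg Prod.snd hπ
      change e.symm (fun i => M i 0 1) = x at h2
      have h3 : (fun i => M i 0 1) = e x := by rw [← h2, e.apply_symm_apply]
      exact congrFun h3 i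
    have ht0 : 0 ≤ t := by rw [← ht]; exact (hpsd i₀).diag_nonneg
    have hxi : ∀ i, x i ^ 2 ≤ M i 0 0 * t := fun i => by
      rw [← hx i, ← ht, ← hL1 i]
      exact sq_apply_le_mul_diag_of_posSemidef (hpsd i) 0 1
    have hsq : ‖x‖ ^ 2 ≤ t ^ 2 := by
      rw [EuclideanSpace.real_norm_sq_eq]
      calc ∑ i, x i ^ 2 ≤ ∑ i, M i 0 0 * t := sum_le_sum fun i _ => hxi i
        _ = t ^ 2 := by rw [← sum_mul, hL2, ht, sq]
    exact (pow_le_pow_iff_left₀ (norm_nonneg x) ht0 two_ne_zero).1 hsq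

end SecondOrderCone

/-! ### Sandwiched sets: nothing between the moment points and `S^{k+1}_+` has an `(S^k_+)^m`-lift -/

/-- **No `(S^k_+)^m`-liftable set between the moment points and the spectraplex** (vectorised): if a
set `D ⊆ ℝ^{(k+1)×(k+1)}` contains all the points `x_t = v_tv_tᵀ/‖v_t‖²`, `t ∈ ℕ`, and is contained in
the `(k+1) × (k+1)` spectraplex, then `D` has no `(S^k_+)^m`-lift, for any `m` — the valid inequalities
`−cᵀXc ≤ 0` of the spectraplex are valid on `D` (`IsNeighborlyWrt.anti`). This is the form of Fawzi's
§4 ("there cannot be any second-order cone representable set that lies between `C` and `S^3_+`", via the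
generalized slack matrix of a pair `K_1 ⊆ K_2`) for the moment curve. [cite: Fawzi2016, §4 (p07)]
[cite: Saunderson2019, Ex. 1.3 with Thm. 1.4 (p04)] [cite: Averkov2019, §4 (p10, "`k`-neighborly
configuration" in `C`, supporting hyperplanes of `C`)] -/
theorem not_hasBlockPsdLift_of_momentPoint_mem (k m : ℕ) {D : Set (Fin (k + 1) × Fin (k + 1) → ℝ)}
    (hD₁ : ∀ t : ℕ, momentPoint (k + 1) t ∈ D) (hD₂ : D ⊆ spectraplexFlat (k + 1)) :
    ¬ HasBlockPsdLift D k m := by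
  rcases Nat.eq_zero_or_pos k with rfl | hk
  · intro h
    have h0 := h.subset_zero_of_eq_zero (Or.inl rfl) (hD₁ 1)
    have hval : momentPoint 1 1 (0, 0) = 1 := by
      simp [momentPoint, momentVec, dotProduct]
    rw [Set.mem_singleton_iff.1 h0] at hval
    exact zero_ne_one hval
  · refine not_hasBlockPsdLift_of_isNeighborlyWrt ((isBounded_spectraplexFlat (k + 1)).subset hD₂)
      fun N => ⟨momentPoints (k + 1) N, (card_momentPoints (by omega) N).ge, ?_,
        (isNeighborlyWrt_spectraplexFlat_momentPoints k N).anti hD₂⟩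
    intro x hx
    obtain ⟨t, -, rfl⟩ := mem_image.1 (mem_coe.1 hx)
    exact hD₁ t

/-- **No `(S^k_+)^m`-liftable set between the rank-one moment matrices and `S^{k+1}_+`** (matrix form,
cone version by homogenisation): if `D ⊆ S^{k+1}_+` contains the unit-trace rank-one matrices
`v_tv_tᵀ/‖v_t‖²`, `v_t = (1, t, …, t^k)`, `t ∈ ℕ`, then `D` has no `(S^k_+)^m`-lift for any `m` (its
unit-trace section would be a lifted set between the moment points and the spectraplex). `D = S^{k+1}_+`
is `not_hasBlockPsdLift_posSemidef`; `k = 2` is Fawzi's sandwiched form of "`S^3_+` has no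
second-order-cone lift". [cite: Fawzi2016, Thm. 1 (p03) and §4 (p07)]
[cite: Saunderson2019, Ex. 1.3, Thm. 1.4 (p04)] -/
theorem not_hasBlockPsdLift_of_vecMulVec_momentVec_mem (k m : ℕ)
    {D : Set (Matrix (Fin (k + 1)) (Fin (k + 1)) ℝ)}
    (hD₁ : ∀ t : ℕ, (momentVec (k + 1) t ⬝ᵥ momentVec (k + 1) t)⁻¹ •
      vecMulVec (momentVec (k + 1) t) (momentVec (k + 1) t) ∈ D)
    (hD₂ : ∀ B ∈ D, B.PosSemidef) : ¬ HasBlockPsdLift D k m := by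
  intro h
  -- the unit-trace section of `D`, vectorised
  have h' := (h.inter_affineSubspace (traceOneAffineSubspace (k + 1))).image (vecLinear (k + 1))
  refine not_hasBlockPsdLift_of_momentPoint_mem k m (fun t => ?_) (fun x hx => ?_) h'
  · refine ⟨Matrix.of fun i j => momentPoint (k + 1) t (i, j), ⟨?_, ?_⟩, by ext p; rfl⟩
    · rw [of_momentPoint]; exact hD₁ t
    · change (Matrix.of fun i j => momentPoint (k + 1) t (i, j)).trace = 1
      exact ((mem_spectraplexFlat_iff _).1 (momentPoint_mem_spectraplexFlat (Nat.succ_pos k) t)).2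
  · obtain ⟨B, ⟨hBD, hBtr⟩, rfl⟩ := hx
    have hBe : (Matrix.of fun i j => vecLinear (k + 1) B (i, j)) = B := by ext i j; rfl
    rw [mem_spectraplexFlat_iff, hBe]
    exact ⟨hD₂ B hBD, hBtr⟩

/-! ### Averkov's orientation: points indexed by `k`-subsets, evaluation-type inequalities indexed by `S` -/

/-- **Averkov's obstruction in his own orientation (Thm. 2, condition (∗)).** For all `k, m ≥ 1` there is
`R` such that: if a bounded `C` has an `(S^k_+)^m`-lift and there are points `f_T ∈ C` indexed by the
`k`-subsets `T` of a finite set `S`, and valid inequalities `a_sᵀy ≤ β_s` of `C` indexed by `s ∈ S`, with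
`a_sᵀ f_T = β_s ⇔ s ∈ T` ("for every `k`-element subset `T` of `S`, some … `f` in the cone `C` is equal to
zero on `T` and is strictly positive on `S ∖ T`", the inequalities being point evaluations), then
`|S| < R`. Proof: factorize the slacks (`HasBlockPsdLift.hasPsdPowerFactorization_slack`) and apply
`averkov_key_lemma` — here the subset-indexed factors come from the points and the point-indexed ones
from the inequalities. (For `k = 0` or `m = 0` the statement fails: `C = {0}` has such lifts and
inequalities `0 ≤ β_s`, `β_s > 0`.) [cite: Averkov2019, Thm. 2 (p05) and §4 (p10–p12, proof via
Lemma 26 and Thm. 19)] [cite: Saunderson2019, Prop. 4.5 (p12)] -/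
theorem exists_card_lt_of_zeroPattern_of_hasBlockPsdLift (k m : ℕ) (hk : 1 ≤ k) (hm : 1 ≤ m) :
    ∃ R : ℕ, ∀ {V : Type u} [Fintype V] {σ : Type u} {C : Set (V → ℝ)}, Bornology.IsBounded C →
      HasBlockPsdLift C k m → ∀ (S : Finset σ) (f : Finset σ → (V → ℝ)) (a : σ → (V → ℝ)) (β : σ → ℝ),
      (∀ T ∈ S.powersetCard k, f T ∈ C) → (∀ s ∈ S, ∀ y ∈ C, a s ⬝ᵥ y ≤ β s) →
      (∀ T ∈ S.powersetCard k, ∀ s ∈ S, (a s ⬝ᵥ f T = β s ↔ s ∈ T)) → S.card < R := by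
  obtain ⟨N, hN⟩ := averkov_key_lemma.{u} k m
  refine ⟨N, fun {V} _ {σ} C hCb hC S f a β hf ha hpat => ?_⟩
  classical
  obtain ⟨A, B, hA, hB, hfac⟩ := hC.hasPsdPowerFactorization_slack (ι := ↥(S.powersetCard k)) (J := ↥S)
    (x := fun T => f T) (a := fun s => a s) (b := fun s => β s) hk hm hCb
    (fun T => hf T T.2) (fun y hy s => ha s s.2 y hy)
  let a' : Finset σ → Fin m → Matrix (Fin k) (Fin k) ℝ := fun T t =>
    if hT : T ∈ S.powersetCard k then A ⟨T, hT⟩ t else 0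
  let b' : σ → Fin m → Matrix (Fin k) (Fin k) ℝ := fun s t =>
    if hs : s ∈ S then B ⟨s, hs⟩ t else 0
  refine hN S a' b' (fun T hT t => by simp only [a', dif_pos hT]; exact hA _ t)
    (fun s hs t => by simp only [b', dif_pos hs]; exact hB _ t) fun T hT s hs => ?_
  have hsum : ∑ t, (a' T t * b' s t).trace = β s - a s ⬝ᵥ f T := by
    have hf' := hfac ⟨T, hT⟩ ⟨s, hs⟩
    simp only at hf'
    rw [hf']
    refine sum_congr rfl fun t _ => ?_
    simp only [a', b', dif_pos hT, dif_pos hs]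
  rw [hsum, sub_eq_zero, eq_comm]
  exact hpat T hT s hs

/-- **No `(S^k_+)^m`-lift from Averkov's condition (∗) on arbitrarily large finite sets** (`k, m ≥ 1`):
if for every `N` there are a finite `S` with `|S| ≥ N`, points `f_T ∈ C` (`T ∈ binom(S,k)`) and valid
inequalities indexed by `S` with the zero pattern `a_sᵀf_T = β_s ⇔ s ∈ T`, then the bounded set `C`
has no `(S^k_+)^m`-lift. [cite: Averkov2019, Thm. 2 (p05)] [cite: Saunderson2019, Thm. 1.4 (p04)] -/
theorem not_hasBlockPsdLift_of_zeroPattern {V : Type u} [Fintype V] {σ : Type u} {C : Set (V → ℝ)}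
    (hCb : Bornology.IsBounded C) {k m : ℕ} (hk : 1 ≤ k) (hm : 1 ≤ m)
    (hS : ∀ N : ℕ, ∃ (S : Finset σ) (f : Finset σ → (V → ℝ)) (a : σ → (V → ℝ)) (β : σ → ℝ),
      N ≤ S.card ∧ (∀ T ∈ S.powersetCard k, f T ∈ C) ∧ (∀ s ∈ S, ∀ y ∈ C, a s ⬝ᵥ y ≤ β s) ∧
        ∀ T ∈ S.powersetCard k, ∀ s ∈ S, (a s ⬝ᵥ f T = β s ↔ s ∈ T)) :
    ¬ HasBlockPsdLift C k m := by
  intro hC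
  obtain ⟨R, hR⟩ := exists_card_lt_of_zeroPattern_of_hasBlockPsdLift.{u} k m hk hm
  obtain ⟨S, f, a, β, hNS, hf, ha, hpat⟩ := hS R
  exact absurd (hR hCb hC S f a β hf ha hpat) (not_lt.2 hNS)

/-! ### Univariate nonnegative polynomials: `sxd(Σ_{1,2d}) = d + 1` (Averkov Cor. 4 for `n = 1`, Thm. 9) -/

section Univariate

open Polynomial

/-- The level set `{x : f x = r}` of a linear functional, as an affine subspace (for sections of lifts,
`HasBlockPsdLift.inter_affineSubspace`). [folklore] -/
def levelAffineSubspace {E : Type*} [AddCommGroup E] [Module ℝ E] (f : E →ₗ[ℝ] ℝ) (r : ℝ) :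
    AffineSubspace ℝ E where
  carrier := {x | f x = r}
  smul_vsub_vadd_mem' c p₁ p₂ p₃ h₁ h₂ h₃ := by
    simp only [Set.mem_setOf_eq, vsub_eq_sub, vadd_eq_add, map_add, map_smul, map_sub,
      smul_eq_mul] at *
    rw [h₁, h₂, h₃]; ring

/-- Membership in the level set. [folklore] -/
@[simp] private theorem mem_levelAffineSubspace {E : Type*} [AddCommGroup E] [Module ℝ E]
    (f : E →ₗ[ℝ] ℝ) (r : ℝ) (x : E) : x ∈ levelAffineSubspace f r ↔ f x = r := Iff.rfl

/-- `Σ_{j<n} p_j x^j = p(x)` for a polynomial of degree `< n`. [folklore] -/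
private theorem sum_coeff_mul_pow_eq_eval {n : ℕ} (p : ℝ[X]) (hp : p.natDegree < n) (x : ℝ) :
    ∑ j : Fin n, p.coeff j * x ^ (j : ℕ) = p.eval x := by
  rw [eval_eq_sum_range' hp]
  exact Fin.sum_univ_eq_sum_range (fun j => p.coeff j * x ^ j) n

/-- **The cone `P_{1,n-1}` of univariate polynomials of degree `< n` nonnegative on `ℝ`**, in coefficient
coordinates `c ∈ ℝ^n ↦ Σ_j c_j x^j` (for even degree `n − 1 = 2d` this is `Σ_{1,2d} = P_{1,2d}`, univariate
nonnegative polynomials being sums of squares). [cite: Averkov2019, §1 (p01–p02, `P_{n,2d}(X)`,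
`Σ_{n,2d}`) and Cor. 4 (p05)] -/
def nonnegPolyCoeff (n : ℕ) : Set (Fin n → ℝ) := {c | ∀ x : ℝ, 0 ≤ ∑ j, c j * x ^ (j : ℕ)}

/-- The polynomial with coefficient vector `c`. [folklore] -/
def polyOfCoeff {n : ℕ} (c : Fin n → ℝ) : ℝ[X] := ∑ j, C (c j) * X ^ (j : ℕ)

/-- Evaluation of `polyOfCoeff`. [folklore] -/
private theorem eval_polyOfCoeff {n : ℕ} (c : Fin n → ℝ) (x : ℝ) :
    (polyOfCoeff c).eval x = ∑ j, c j * x ^ (j : ℕ) := by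
  simp [polyOfCoeff, eval_finsetSum]

/-- Coefficients of `polyOfCoeff`. [folklore] -/
private theorem coeff_polyOfCoeff {n : ℕ} (c : Fin n → ℝ) (j : Fin n) :
    (polyOfCoeff c).coeff j = c j := by
  simp only [polyOfCoeff, finsetSum_coeff, coeff_C_mul, coeff_X_pow]
  rw [Finset.sum_eq_single j]
  · simp
  · intro i _ hij
    rw [if_neg fun h => hij (Fin.ext h.symm), mul_zero]
  · simp

/-- `polyOfCoeff c` has degree `< n`. [folklore] -/
private theorem degree_polyOfCoeff_lt {n : ℕ} (c : Fin n → ℝ) : (polyOfCoeff c).degree < n := by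
  refine lt_of_le_of_lt (degree_sum_le _ _) ?_
  refine (Finset.sup_lt_iff (WithBot.bot_lt_coe n)).2 fun j _ => ?_
  exact lt_of_le_of_lt (degree_C_mul_X_pow_le _ _) (WithBot.coe_lt_coe.2 j.2)

/-- Two coefficient vectors with the same polynomial function are equal. [folklore] -/
private theorem eq_of_forall_sum_mul_pow_eq {n : ℕ} {c c' : Fin n → ℝ}
    (h : ∀ x : ℝ, ∑ j, c j * x ^ (j : ℕ) = ∑ j, c' j * x ^ (j : ℕ)) : c = c' := by
  have hp : polyOfCoeff c = polyOfCoeff c' :=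
    Polynomial.funext fun x => by rw [eval_polyOfCoeff, eval_polyOfCoeff, h]
  funext j
  rw [← coeff_polyOfCoeff c j, ← coeff_polyOfCoeff c' j, hp]

/-- The constant polynomial `1` lies in the cone and is a nonzero vector (`n ≥ 1`). [folklore] -/
private theorem single_zero_one_mem_nonnegPolyCoeff (n : ℕ) :
    (Pi.single (⟨0, Nat.succ_pos n⟩ : Fin (n + 1)) (1 : ℝ)) ∈ nonnegPolyCoeff (n + 1) := by
  intro x
  rw [Finset.sum_eq_single (⟨0, Nat.succ_pos n⟩ : Fin (n + 1))]
  · simp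
  · intro j _ hj
    rw [Pi.single_eq_of_ne hj, zero_mul]
  · simp

/-- Degenerate lifts of the cone are impossible: it contains the nonzero point `1`. [folklore] -/
private theorem not_hasBlockPsdLift_nonnegPolyCoeff_of_eq_zero (n d r : ℕ) (h0 : d = 0 ∨ r = 0) :
    ¬ HasBlockPsdLift (nonnegPolyCoeff (n + 1)) d r := by
  intro h
  have h1 := h.subset_zero_of_eq_zero h0 (single_zero_one_mem_nonnegPolyCoeff n)
  have h2 := congrFun (Set.mem_singleton_iff.1 h1) ⟨0, Nat.succ_pos n⟩
  simp at h2

/-- The Gram (moment) map `Q ↦ (Σ_{i+j=l} Q_{ij})_l` from `(d+1) × (d+1)` matrices to coefficient vectors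
of degree `≤ 2d`: `Σ_l (gram Q)_l x^l = v(x)ᵀ Q v(x)`, `v(x) = (1, x, …, x^d)`.
[cite: Averkov2019, §1 (p02, "`Σ_{n,2d}` has a semidefinite extended formulation with one LMI of size
`binom(n+d,n)`") and Cor. 4 (p05)] -/
def gramCoeff (d : ℕ) : Matrix (Fin (d + 1)) (Fin (d + 1)) ℝ →ₗ[ℝ] (Fin (2 * d + 1) → ℝ) where
  toFun Q l := ∑ i : Fin (d + 1), ∑ j : Fin (d + 1), if (i : ℕ) + (j : ℕ) = (l : ℕ) then Q i j else 0
  map_add' Q Q' := by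
    funext l
    rw [Pi.add_apply, ← sum_add_distrib]
    refine sum_congr rfl fun i _ => ?_
    rw [← sum_add_distrib]
    refine sum_congr rfl fun j _ => ?_
    split_ifs <;> simp
  map_smul' a Q := by
    funext l
    simp only [Matrix.smul_apply, Pi.smul_apply, smul_eq_mul, mul_sum, RingHom.id_apply]
    refine sum_congr rfl fun i _ => sum_congr rfl fun j _ => ?_
    split_ifs <;> simp

/-- `Σ_l (gram Q)_l x^l = Σ_{i,j} Q_{ij} x^{i+j}`. [cite: Averkov2019, §1 (p02)] -/
private theorem sum_gramCoeff_mul_pow {d : ℕ} (Q : Matrix (Fin (d + 1)) (Fin (d + 1)) ℝ) (x : ℝ) :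
    ∑ l : Fin (2 * d + 1), gramCoeff d Q l * x ^ (l : ℕ) =
      ∑ i : Fin (d + 1), ∑ j : Fin (d + 1), Q i j * x ^ ((i : ℕ) + j) := by
  have key : ∀ i j : Fin (d + 1),
      ∑ l : Fin (2 * d + 1), (if (i : ℕ) + (j : ℕ) = (l : ℕ) then Q i j else 0) * x ^ (l : ℕ) =
        Q i j * x ^ ((i : ℕ) + j) := by
    intro i j
    have hl : (i : ℕ) + j < 2 * d + 1 := by omega
    rw [Finset.sum_eq_single ⟨(i : ℕ) + j, hl⟩]
    · simp
    · intro l _ hl'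
      have : ¬ ((i : ℕ) + (j : ℕ) = (l : ℕ)) := fun h => hl' (Fin.ext h.symm)
      rw [if_neg this, zero_mul]
    · simp
  calc ∑ l : Fin (2 * d + 1), gramCoeff d Q l * x ^ (l : ℕ)
      = ∑ l : Fin (2 * d + 1), ∑ i : Fin (d + 1), ∑ j : Fin (d + 1),
          (if (i : ℕ) + (j : ℕ) = (l : ℕ) then Q i j else 0) * x ^ (l : ℕ) := by
        refine sum_congr rfl fun l _ => ?_
        simp only [gramCoeff, LinearMap.coe_mk, AddHom.coe_mk, sum_mul]
    _ = ∑ i : Fin (d + 1), ∑ j : Fin (d + 1), ∑ l : Fin (2 * d + 1),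
          (if (i : ℕ) + (j : ℕ) = (l : ℕ) then Q i j else 0) * x ^ (l : ℕ) := by
        rw [sum_comm]
        exact sum_congr rfl fun i _ => sum_comm
    _ = _ := sum_congr rfl fun i _ => sum_congr rfl fun j _ => key i j

/-- `Σ_{i,j} Q_{ij} x^{i+j} = v(x)ᵀ Q v(x)`. [folklore] -/
private theorem sum_sum_mul_pow_add_eq_dotProduct {d : ℕ} (Q : Matrix (Fin (d + 1)) (Fin (d + 1)) ℝ)
    (x : ℝ) :
    ∑ i : Fin (d + 1), ∑ j : Fin (d + 1), Q i j * x ^ ((i : ℕ) + j) =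
      (fun i : Fin (d + 1) => x ^ (i : ℕ)) ⬝ᵥ (Q *ᵥ fun i : Fin (d + 1) => x ^ (i : ℕ)) := by
  simp only [dotProduct, mulVec, mul_sum, pow_add]
  refine sum_congr rfl fun i _ => sum_congr rfl fun j _ => ?_
  ring

/-- For `p = a² + b²` over `ℝ`: `2 deg a ≤ deg p` (no cancellation of leading terms). [folklore] -/
private theorem two_mul_natDegree_le_of_eq_sq_add_sq {p a b : ℝ[X]} (h : p = a ^ 2 + b ^ 2) :
    2 * a.natDegree ≤ p.natDegree := by
  by_cases ha : a = 0
  · simp [ha]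
  have hlc : (a ^ 2).leadingCoeff + (b ^ 2).leadingCoeff ≠ 0 := by
    rw [leadingCoeff_pow, leadingCoeff_pow]
    have hlc0 : a.leadingCoeff ≠ 0 := leadingCoeff_ne_zero.2 ha
    have : 0 < a.leadingCoeff ^ 2 := by positivity
    nlinarith [sq_nonneg b.leadingCoeff]
  have hdeg := degree_add_eq_of_leadingCoeff_add_ne_zero hlc
  have h2 : (a ^ 2).degree ≤ p.degree := by rw [h, hdeg]; exact le_max_left _ _
  have h3 := natDegree_le_natDegree h2
  rwa [natDegree_pow] at h3

/-- **`Σ_{1,2d} = P_{1,2d}` has an `S^{d+1}_+`-lift** (one LMI of size `d + 1 = binom(1+d, 1)`): the Gram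
parametrization `p = v(x)ᵀQv(x)`, `Q ⪰ 0`, reaches every nonnegative univariate polynomial of degree
`≤ 2d` because such a polynomial is a sum of two squares (`UnivariateNonnegSumOfSquares`, Laurent
Lemma 3.5; `Q = ααᵀ + ββᵀ`). [cite: Averkov2019, §1 (p02) and Cor. 4 (p05, the upper bound
`sxd(Σ_{n,2d}) ≤ binom(n+d,n)`)] -/
theorem hasBlockPsdLift_nonnegPolyCoeff_succ (d : ℕ) :
    HasBlockPsdLift (nonnegPolyCoeff (2 * d + 1)) (d + 1) 1 := by
  classical
  refine ⟨⊤, gramCoeff d ∘ₗ LinearMap.proj 0, ?_⟩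
  ext c
  constructor
  · intro hc
    -- `p = a² + b²` with `deg a, deg b ≤ d`
    have hp : ∀ x, 0 ≤ (polyOfCoeff c).eval x := fun x => by rw [eval_polyOfCoeff]; exact hc x
    obtain ⟨a, b, hab⟩ :=
      Literature.Algebra.Polynomial.UnivariateNonnegSumOfSquares.exists_sq_add_sq_of_nonneg hp
    have hpdeg : (polyOfCoeff c).natDegree ≤ 2 * d := by
      have h1 := degree_polyOfCoeff_lt c
      by_cases h0 : polyOfCoeff c = 0
      · rw [h0, natDegree_zero]; exact Nat.zero_le _
      · have := (natDegree_lt_iff_degree_lt h0).2 h1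
        omega
    have hda : a.natDegree < d + 1 := by
      have := two_mul_natDegree_le_of_eq_sq_add_sq hab; omega
    have hdb : b.natDegree < d + 1 := by
      have := two_mul_natDegree_le_of_eq_sq_add_sq (by rw [hab, add_comm] : polyOfCoeff c = b ^ 2 + a ^ 2)
      omega
    let qa : Fin (d + 1) → ℝ := fun i => a.coeff i
    let qb : Fin (d + 1) → ℝ := fun i => b.coeff i
    refine ⟨fun _ => vecMulVec qa qa + vecMulVec qb qb, ⟨fun _ => ?_, AffineSubspace.mem_top ℝ _ _⟩, ?_⟩
    · have h1 := posSemidef_vecMulVec_self_star qa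
      have h2 := posSemidef_vecMulVec_self_star qb
      rw [star_trivial] at h1 h2
      exact h1.add h2
    · change gramCoeff d (vecMulVec qa qa + vecMulVec qb qb) = c
      refine eq_of_forall_sum_mul_pow_eq fun x => ?_
      rw [sum_gramCoeff_mul_pow, ← eval_polyOfCoeff, hab, eval_add, eval_pow, eval_pow,
        ← sum_coeff_mul_pow_eq_eval a hda, ← sum_coeff_mul_pow_eq_eval b hdb]
      simp only [Matrix.add_apply, vecMulVec_apply, qa, qb, add_mul, sum_add_distrib, sq, sum_mul_sum,
        pow_add]
      congr 1 <;> exact sum_congr rfl fun i _ => sum_congr rfl fun j _ => by ring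
  · rintro ⟨M, ⟨hM, -⟩, rfl⟩ x
    change 0 ≤ ∑ l, gramCoeff d (M 0) l * x ^ (l : ℕ)
    rw [sum_gramCoeff_mul_pow, sum_sum_mul_pow_add_eq_dotProduct]
    have h := (hM 0).dotProduct_mulVec_nonneg (fun i : Fin (d + 1) => x ^ (i : ℕ))
    rwa [star_trivial] at h

/-- The evaluation map `c ↦ (p_c(s))_{s < n}` at the nodes `0, …, n−1` is an injective linear
endomorphism of `ℝ^n` (a polynomial of degree `< n` with `n` roots vanishes). [folklore] -/
private def nodeEval (n : ℕ) : (Fin n → ℝ) →ₗ[ℝ] (Fin n → ℝ) where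
  toFun c s := ∑ j, c j * ((s : ℕ) : ℝ) ^ (j : ℕ)
  map_add' c c' := by
    funext s; simp only [Pi.add_apply, add_mul, sum_add_distrib]
  map_smul' a c := by
    funext s; simp only [Pi.smul_apply, smul_eq_mul, mul_assoc, ← mul_sum, RingHom.id_apply]

/-- The node-evaluation map is injective: a polynomial of degree `< n` vanishing at the `n` nodes
`0, …, n−1` is zero. [folklore] -/
private theorem nodeEval_injective (n : ℕ) : Function.Injective (nodeEval n) := by
  intro c c' h
  rcases Nat.eq_zero_or_pos n with rfl | hn
  · exact Subsingleton.elim _ _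
  have hp : polyOfCoeff c - polyOfCoeff c' = 0 := by
    refine eq_zero_of_natDegree_lt_card_of_eval_eq_zero _ (f := fun s : Fin n => ((s : ℕ) : ℝ))
      (fun s t hst => Fin.ext (by simp only at hst; exact_mod_cast hst)) (fun s => ?_) ?_
    · have hs := congrFun h s
      simp only [nodeEval, LinearMap.coe_mk, AddHom.coe_mk] at hs
      rw [eval_sub, eval_polyOfCoeff, eval_polyOfCoeff, hs, sub_self]
    · rw [Fintype.card_fin]
      by_cases h0 : polyOfCoeff c - polyOfCoeff c' = 0
      · rw [h0, natDegree_zero]; exact hn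
      · exact (natDegree_lt_iff_degree_lt h0).2
          (lt_of_le_of_lt (degree_sub_le _ _)
            (max_lt (degree_polyOfCoeff_lt c) (degree_polyOfCoeff_lt c')))
  funext j
  have := congrArg (fun q => q.coeff (j : ℕ)) hp
  simp only [coeff_sub, coeff_polyOfCoeff, coeff_zero] at this
  linarith

/-- The section of the cone by `Σ_{s<n} p(s) = 1` is bounded (`0 ≤ p(s) ≤ 1` at `n` nodes, and the
node-evaluation map is a linear isomorphism). [folklore] -/
private theorem isBounded_nonnegPolyCoeff_inter (n : ℕ) :
    Bornology.IsBounded (nonnegPolyCoeff n ∩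
      (levelAffineSubspace ((∑ s : Fin n, LinearMap.proj s) ∘ₗ nodeEval n) 1 : Set (Fin n → ℝ))) := by
  classical
  -- the evaluation isomorphism
  let e : (Fin n → ℝ) ≃ₗ[ℝ] (Fin n → ℝ) :=
    (nodeEval n).linearEquivOfInjective (nodeEval_injective n) rfl
  let ec : (Fin n → ℝ) ≃L[ℝ] (Fin n → ℝ) := e.toContinuousLinearEquiv
  have hB : Bornology.IsBounded {v : Fin n → ℝ | ∀ s, |v s| ≤ 1} := by
    rw [isBounded_iff_forall_norm_le]
    refine ⟨1, fun v hv => (pi_norm_le_iff_of_nonneg zero_le_one).2 fun s => ?_⟩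
    rw [Real.norm_eq_abs]; exact hv s
  refine ((ec.symm : (Fin n → ℝ) →L[ℝ] (Fin n → ℝ)).lipschitz.isBounded_image hB).subset ?_
  rintro c ⟨hc, hc1⟩
  have hc1' : ∑ s : Fin n, nodeEval n c s = 1 := by
    have h := hc1
    change ((∑ s : Fin n, LinearMap.proj s) ∘ₗ nodeEval n) c = 1 at h
    simpa [LinearMap.sum_apply] using h
  have hnn : ∀ s : Fin n, 0 ≤ nodeEval n c s := fun s => hc _
  refine ⟨ec c, fun s => ?_, ?_⟩
  · change |e c s| ≤ 1
    rw [LinearMap.linearEquivOfInjective_apply, abs_of_nonneg (hnn s), ← hc1']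
    exact single_le_sum (f := fun s => nodeEval n c s) (fun s _ => hnn s) (mem_univ s)
  · exact ec.symm_apply_apply c

/-- **`Σ_{1,2d} = P_{1,2d}` has no `(S^d_+)^m`-lift, for any `m`** (Averkov Cor. 3/4 for `n = 1`: the lower
bound `sxd(Σ_{1,2d}) ≥ binom(1+d,1) = d + 1`; `d = 2`: Ahmadi et al. / Fawzi, nonnegative univariate
quartics are not second-order-cone representable with `2 × 2` blocks, Averkov Thm. 9). Proof = Averkov's
(∗) with `X = ℝ`: on the bounded section `Σ_{s ≤ 2d} p(s) = 1` of the cone, the normalized polynomials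
`f_T = Π_{t∈T}(x − t)² / Z_T` (`T` a `d`-subset of `{0, …, N−1}`) and the evaluations `p ↦ p(s)` have the
zero pattern `f_T(s) = 0 ⇔ s ∈ T`; `not_hasBlockPsdLift_of_zeroPattern`.
[cite: Averkov2019, Thm. 2, Cor. 3, Cor. 4, Thm. 9 (p05); §4 (p10–p12)] -/
theorem not_hasBlockPsdLift_nonnegPolyCoeff (d m : ℕ) :
    ¬ HasBlockPsdLift (nonnegPolyCoeff (2 * d + 1)) d m := by
  classical
  rcases Nat.eq_zero_or_pos d with hd | hd
  · exact not_hasBlockPsdLift_nonnegPolyCoeff_of_eq_zero (2 * d) d m (Or.inl hd)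
  rcases Nat.eq_zero_or_pos m with hm | hm
  · exact not_hasBlockPsdLift_nonnegPolyCoeff_of_eq_zero (2 * d) d m (Or.inr hm)
  intro h
  -- the bounded section `Σ_{s ≤ 2d} p(s) = 1`
  set n := 2 * d + 1 with hn
  set Lev := levelAffineSubspace ((∑ s : Fin n, LinearMap.proj s) ∘ₗ nodeEval n) 1 with hLev
  have hsec := h.inter_affineSubspace Lev
  refine not_hasBlockPsdLift_of_zeroPattern (σ := ℕ) (isBounded_nonnegPolyCoeff_inter n) hd hm
    (fun N => ?_) hsec
  -- points `f_T`, `T ∈ binom(range N, d)`, and evaluations at `s ∈ range N`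
  let q : Finset ℕ → ℝ[X] := fun T => ∏ t ∈ T, (X - C (t : ℝ))
  let Z : Finset ℕ → ℝ := fun T => ∑ s : Fin n, ((q T) ^ 2).eval ((s : ℕ) : ℝ)
  let f : Finset ℕ → (Fin n → ℝ) := fun T j => ((q T) ^ 2).coeff j / Z T
  let a : ℕ → (Fin n → ℝ) := fun s j => -(((s : ℝ)) ^ (j : ℕ))
  have hqeval : ∀ (T : Finset ℕ) (x : ℝ), (q T).eval x = ∏ t ∈ T, (x - t) := by
    intro T x
    simp only [q, eval_prod, eval_sub, eval_X, eval_C]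
  have hqzero : ∀ (T : Finset ℕ) (s : ℕ), (q T).eval (s : ℝ) = 0 ↔ s ∈ T := by
    intro T s
    rw [hqeval, prod_eq_zero_iff]
    constructor
    · rintro ⟨t, ht, h0⟩
      have : (s : ℝ) = t := sub_eq_zero.1 h0
      have hst : s = t := by exact_mod_cast this
      rwa [hst]
    · intro hs; exact ⟨s, hs, sub_self _⟩
  have hdegq2 : ∀ T : Finset ℕ, T.card = d → ((q T) ^ 2).natDegree < n := by
    intro T hT
    rw [natDegree_pow, show (q T).natDegree = T.card from natDegree_finsetProd_X_sub_C_eq_card _ _, hT]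
    omega
  have hfeval : ∀ T : Finset ℕ, T.card = d → ∀ x : ℝ,
      ∑ j : Fin n, f T j * x ^ (j : ℕ) = ((q T).eval x) ^ 2 / Z T := by
    intro T hT x
    simp only [f, div_mul_eq_mul_div, ← sum_div]
    rw [sum_coeff_mul_pow_eq_eval _ (hdegq2 T hT), eval_pow]
  -- `Z_T > 0`: some node `s ≤ 2d` is not in `T` (|T| = d < 2d+1)
  have hZpos : ∀ T : Finset ℕ, T.card = d → 0 < Z T := by
    intro T hT
    have hex : ∃ s : Fin n, (s : ℕ) ∉ T := by
      by_contra hall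
      push Not at hall
      have hsub : (Finset.univ : Finset (Fin n)).image (fun s : Fin n => (s : ℕ)) ⊆ T := by
        intro t ht
        obtain ⟨s, -, rfl⟩ := mem_image.1 ht
        exact hall s
      have hcard := card_le_card hsub
      rw [card_image_of_injective _ Fin.val_injective, card_univ, Fintype.card_fin, hT] at hcard
      omega
    obtain ⟨s₀, hs₀⟩ := hex
    have hterm : 0 < ((q T) ^ 2).eval ((s₀ : ℕ) : ℝ) := by
      rw [eval_pow]
      have hne : (q T).eval ((s₀ : ℕ) : ℝ) ≠ 0 := fun h0 => hs₀ ((hqzero T s₀).1 h0)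
      positivity
    exact lt_of_lt_of_le hterm (single_le_sum (f := fun s : Fin n => ((q T) ^ 2).eval ((s : ℕ) : ℝ))
      (fun s _ => by rw [eval_pow]; positivity) (mem_univ s₀))
  refine ⟨Finset.range N, f, a, fun _ => 0, by rw [card_range], ?_, ?_, ?_⟩
  · -- `f_T` lies in the section
    intro T hT
    have hTd : T.card = d := (mem_powersetCard.1 hT).2
    refine ⟨fun x => ?_, ?_⟩
    · rw [hfeval T hTd x]
      exact div_nonneg (sq_nonneg _) (hZpos T hTd).le
    · change ((∑ s : Fin n, LinearMap.proj s) ∘ₗ nodeEval n) (f T) = 1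
      have hev : ∀ s : Fin n, nodeEval n (f T) s = ((q T).eval ((s : ℕ) : ℝ)) ^ 2 / Z T := fun s => by
        simp only [nodeEval, LinearMap.coe_mk, AddHom.coe_mk]
        exact hfeval T hTd _
      simp only [LinearMap.comp_apply, LinearMap.sum_apply, LinearMap.proj_apply, hev, ← sum_div,
        ← eval_pow]
      exact div_self (hZpos T hTd).ne'
  · -- the evaluations are valid inequalities: `−p(s) ≤ 0`
    rintro s - y ⟨hy, -⟩
    have h0 := hy (s : ℝ)
    have : a s ⬝ᵥ y = -∑ j, y j * (s : ℝ) ^ (j : ℕ) := by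
      rw [dotProduct, ← sum_neg_distrib]
      exact sum_congr rfl fun j _ => by simp only [a]; ring
    rw [this]; linarith
  · -- the zero pattern `f_T(s) = 0 ⇔ s ∈ T`
    intro T hT s hs
    have hTd : T.card = d := (mem_powersetCard.1 hT).2
    have : a s ⬝ᵥ f T = -∑ j, f T j * (s : ℝ) ^ (j : ℕ) := by
      rw [dotProduct, ← sum_neg_distrib]
      exact sum_congr rfl fun j _ => by simp only [a]; ring
    rw [this, neg_eq_zero, hfeval T hTd, div_eq_zero_iff, or_iff_left (hZpos T hTd).ne',
      sq_eq_zero_iff, hqzero]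

/-- **Averkov 2019, Corollary 4 for `n = 1` (and Theorem 9 for `d = 2`): `sxd(Σ_{1,2d}) = d + 1`** — the
least block size `k` for which the cone of nonnegative univariate polynomials of degree `≤ 2d` has an
`(S^k_+)^m`-lift for some `m` is `d + 1` (`"sxd(Σ_{n,2d}) = sxc(Σ_{n,2d}) = binom(n+d,n)"`; Thm. 9
(Ahmadi et al., Fawzi): `sxd(Σ_{1,4}) = 3`). [cite: Averkov2019, Def. 1 (p03), Cor. 4 and Thm. 9 (p05)] -/
theorem isLeast_blockSize_hasBlockPsdLift_nonnegPolyCoeff (d : ℕ) :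
    IsLeast {k : ℕ | ∃ m : ℕ, HasBlockPsdLift (nonnegPolyCoeff (2 * d + 1)) k m} (d + 1) := by
  refine ⟨⟨1, hasBlockPsdLift_nonnegPolyCoeff_succ d⟩, fun k hk => ?_⟩
  obtain ⟨m, hm⟩ := hk
  by_contra hlt
  exact not_hasBlockPsdLift_nonnegPolyCoeff d m (hm.mono_size (by omega))

end Univariate

end Literature.Combinatorics.Optimization

end
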